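import Literature.Probability.RandomPlanarGeometry.HexSAWRotTourFrame
import HarnessLib

/-!
# The rotated Glazman–Manolescu tour in Beaton's frame: pieces, gluing, decoding, and the block inequality for the rotated triangles

Topic `Literature/Probability/RandomPlanarGeometry`; lane «pcv-sawmu», door R95 «HEX-BW-GM-ROT» (planner a-idea-1,
typed layer `Sketch_G16_K954.lean` e4e31e90a0589e7a, rebased editions G17d/G17e; tree edition split by prover a-p6 g7,
statements token-identical to the HOME kernel text G17e 1637ea746fc4e499 unless said in the file header).
Sources: A. Glazman, I. Manolescu, *Self-avoiding walk on ℤ² with Yang–Baxter weights: universality of critical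
fugacity and 2-point function* (arXiv:1708.00395; AIHP 2020), §4.1, Lemma 4.1 and Proposition 1.1 (the three
rotated triangles and the block inequality); N. R. Beaton, *The critical surface fugacity of self-avoiding walks on a
rotated honeycomb lattice*, J. Phys. A 47 (2014) 075003 (arXiv:1210.0274v3), §2.2, Proposition 4, Appendix Thm 14.

SECTION 1 (Part F1–F2 of the HOME text): the PIECES of the tour — the finsets `rotSideWalksL/R` of right-started
walks of `T_k ∖ {a⁻}` leaving through the left/right side line (masses `α_k`, `β_k`), the class normalisation
`clsPt`/`placeIso`, exit data `exitH/exitK/exitUp` (exit height, ray-edge index `⌊(h-1)/3⌋ ≤ 2k`, arrival flag), the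
ANATOMY of a piece (`a⁻ :: (l ++ [u])`, `u` on the class-normalised left line), and the generic junction glue
(`sameB`, `segOf`, `arrOf`, `segOf_spec`, `isChain_append_of_junction`).

SECTION 2 (Part F3 of the HOME text): the GLUED TOUR in the frame `c₀` as one explicit list `rotTour M P₁ b₂ P₂ b₃ P₃`
and the gluing theorem `rotTour_spec`: for `M ≥ 1`, `H, W ≥ 28M`, the glued list is a right-started self-avoiding
mid-walk of Beaton's domain `D(H, W) ∖ {a⁻}` whose final dart is a bottom exit in the window of block `M`, of length
`≤ ℓ(P₁) + ℓ(P₂) + ℓ(P₃) + 2` (Glazman–Manolescu's concatenation («tour») inequality of the proof of Proposition 1.1, arXiv v3 p. 13 — walk level, in Beaton's frame).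

SECTION 3 — Part G (T2b, a-idea-1 g16, HOME-only) — BOTH FRAMES: piece 1 of class `b₁`

Frame `c₀` (`b₁ = false`): piece 1 is a LEFT exit of `T_M` and pieces 2, 3 are placed by `Φ₂ ∘ clsPt b₂`,
`Φ₃ ∘ clsPt b₃` (Part F).  Frame `c₁` (`b₁ = true`): piece 1 is a RIGHT exit of `T_M`; the whole continuation is the
mirror image — pieces 2, 3 are placed by `reflX ∘ Φ₂ ∘ clsPt b₂`, `reflX ∘ Φ₃ ∘ clsPt b₃`.  One theorem
`rotTourG_spec` covers both: the Part F proof verbatim in the coordinates `(ξ, Y)` with `Y v := X(clsPt b₁ v)`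
(`= X` resp. `6 − X`); `|Y − 3| = |X − 3|`, so bottom darts and the window are frame-independent.  With
`rotChi M = max (rotSideL M) (rotSideR M)` the frame is chosen ONCE per block (the class attaining the max), so the

FIRST (moved here from Part D so that no unproved `Prop` is left in a parent file): the FACE **K95.4a** `RotTourKeyIneq` (the rotated
Glazman–Manolescu tour as ONE mass inequality, token-identical to the planner's typed layer e4e31e90 l. 998), the face **K95.4**
`RotTriBlockIneq`, and the derivation `rotTriBlockIneq_of_tour : RotTourKeyIneq → RotTriBlockIneq` (A = (K/2)/c_I · (2c_B)³/x_c²).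

SECTION 4 — Part H (T4, a-idea-1 g16, HOME-only) — DECODING: the glued tour determines its three pieces

For FIXED class data (frame `b₁`, class function `β : ℕ → Bool` — with `rotChi k = max (rotSideL k) (rotSideR k)`
the class attaining the max is chosen once per block), the map `(P₁, P₂, P₃) ↦ rotTourG M b₁ P₁ (β (exitK P₁)) P₂
(β (exitK P₂)) P₃` is injective on the domain of `rotTourG_spec`.  Mechanism: a list splits in at most one way as
`l ++ u :: r` with `l ⊂ S`, `u ∉ S` (`splitMem_unique`; the tree has the special case `split_unique` of one letter absent from both prefixes, HexSAWObservable), applied at `S = T_M` (piece 1 = the prefix up to the first exit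
from `T_M`), then at `S = ψ₂(T_K)` and `S = ψ₃(T_{K'})`.  No statement of record is touched.

and then THE WEIGHTED SUM (Part I): with the frame `b₁` and the class function `β` chosen as the classes attaining
`rotChi k = max (rotSideL k) (rotSideR k)`, the injection (`rotTourG_inj`) and the landing/length control
(`rotTourG_spec`) give, at `x = x_c < 1`, `rotBotWin M H W ≥ Σ_{(P₁,P₂,P₃)} x^{ℓ₁+ℓ₂+ℓ₃+2} ≥ x² · rotChi M · c₂ · c₃`,
i.e. **K95.4a** `rotTourKeyIneq_holds : RotTourKeyIneq`, and hence **K95.4** `rotTriBlockIneq_holds : RotTriBlockIneq`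
(the block inequality `(m+1) · W(4·20^m)³ ≤ A` for Beaton's rotated triangles, unconditional).
-/

noncomputable section

open Finset Filter Topology
open scoped BigOperators


/-! ## Section: HexSAWRotTourPieces -/

namespace Literature.Probability.RandomPlanarGeometry.SAW.HV

/-! ## Part F — C-K954A-T2a (a-idea-1 g16, 2026-08-23): WALK-LEVEL GLUE for the K95.4a tour (ROUTES-G16 §4.4 T2)

Appended behind Part E (T1).  F1 = the pieces (side-walk finsets, exit data, anatomy); F2 = generic junction
lemmas; F3 = the glued list `rotTour` (c₀ frame) and its `IsMidWalk` / window / length theorem.  No statement of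
record changes; `RotTourKeyIneq` itself still needs T4 (decoding ⇒ injectivity), T5 (the `c₁` mirror) and T6 (the
weighted sum) on top of this part. -/

/-! ### F1. The pieces: side-exiting walks of `T_k`, their exit data and anatomy -/

/-- right-started walks of `T_M ∖ {a⁻}` leaving through the LEFT side line (mass `rotSideL M`). [cite: GlazmanManolescu2019, §4.1] -/
def rotSideWalksL (M : ℕ) : Finset (List HV) :=
  (midWalks ((rotTriV M).erase wOut)).filter fun P => IsRotSideL M (finalDart P)
/-- right-started walks of `T_M ∖ {a⁻}` leaving through the RIGHT side line (mass `rotSideR M`). [cite: GlazmanManolescu2019, §4.1] -/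
def rotSideWalksR (M : ℕ) : Finset (List HV) :=
  (midWalks ((rotTriV M).erase wOut)).filter fun P => IsRotSideR M (finalDart P)

/-- `α_M` as the sum over the left-exit pieces. [cite: GlazmanManolescu2019, §4.1] -/
theorem rotSideL_eq (M : ℕ) : rotSideL M = ∑ P ∈ rotSideWalksL M, hexCriticalFugacity ^ mwLen P := rfl
/-- `β_M` as the sum over the right-exit pieces. [cite: GlazmanManolescu2019, §4.1] -/
theorem rotSideR_eq (M : ℕ) : rotSideR M = ∑ P ∈ rotSideWalksR M, hexCriticalFugacity ^ mwLen P := rfl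

/-- the pieces of class `b`: `false` = left exits used as they are, `true` = right exits, used mirrored by `reflX`
(the ray-edge shuffle of ROUTES-G15 §2.3 S4 makes both classes available at every junction). [cite: GlazmanManolescu2019, §4.1] -/
def rotSideWalks : Bool → ℕ → Finset (List HV)
  | false, M => rotSideWalksL M
  | true, M => rotSideWalksR M

/-- the class-normalising point map: identity / the mirror `reflX`. [folklore] -/
def clsPt : Bool → HV → HV
  | false, v => v
  | true, v => reflX v

/-- the placement of a piece of class `b` by `Φ`: `Φ` itself / `reflX ≫ Φ`, as a graph automorphism. [folklore] -/
def placeIso (Φ : hvGraph ≃g hvGraph) : Bool → hvGraph ≃g hvGraph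
  | false => Φ
  | true => reflX.trans Φ

/-- The placement acts by `Φ ∘ clsPt b`. [cite: GlazmanManolescu2019, §4.1 (proof of Proposition 1.1: the concatenation («tour») inequality, arXiv:1708.00395v3 p. 13, unnumbered)] -/
@[simp] theorem placeIso_apply (Φ : hvGraph ≃g hvGraph) (b : Bool) (v : HV) : placeIso Φ b v = Φ (clsPt b v) := by
  cases b <;> rfl

/-- The mirror class swaps `a⁻ ↦ a⁺`. [cite: GlazmanManolescu2019, §4.1 (proof of Proposition 1.1: the concatenation («tour») inequality, arXiv:1708.00395v3 p. 13, unnumbered)] -/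
@[simp] theorem clsPt_wOut_true : clsPt true wOut = hvOrigin := reflX_wOut
/-- The mirror class swaps `a⁺ ↦ a⁻`. [cite: GlazmanManolescu2019, §4.1 (proof of Proposition 1.1: the concatenation («tour») inequality, arXiv:1708.00395v3 p. 13, unnumbered)] -/
@[simp] theorem clsPt_hvOrigin_true : clsPt true hvOrigin = wOut := reflX_hvOrigin
/-- The class-`false` normalisation is the identity. [cite: GlazmanManolescu2019, §4.1 (proof of Proposition 1.1: the concatenation («tour») inequality, arXiv:1708.00395v3 p. 13, unnumbered)] -/
@[simp] theorem clsPt_false (v : HV) : clsPt false v = v := rfl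
/-- The class normalisation preserves Beaton's height `-ξ`. [cite: GlazmanManolescu2019, §4.1 (proof of Proposition 1.1: the concatenation («tour») inequality, arXiv:1708.00395v3 p. 13, unnumbered)] -/
@[simp] theorem xi_clsPt (b : Bool) (v : HV) : xi (clsPt b v) = xi v := by
  cases b
  · rfl
  · exact xi_reflX v

/-- The mirror class acts on the abscissa by `X ↦ 6 - X`. [cite: GlazmanManolescu2019, §4.1 (proof of Proposition 1.1: the concatenation («tour») inequality, arXiv:1708.00395v3 p. 13, unnumbered)] -/
theorem xX_clsPt_true (v : HV) : xX (clsPt true v) = 6 - xX v := xX_reflX v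

/-- The class normalisation is injective. [cite: GlazmanManolescu2019, §4.1 (proof of Proposition 1.1: the concatenation («tour») inequality, arXiv:1708.00395v3 p. 13, unnumbered)] -/
theorem clsPt_injective (b : Bool) : Function.Injective (clsPt b) := by
  cases b
  · exact fun _ _ h => h
  · exact fun _ _ h => reflX.injective h

/-- `clsPt b` preserves `T_k ∖ {a∓}` (it is the identity or the mirror, which swaps `a∓`). [cite: GlazmanManolescu2019, §4.1 (proof of Proposition 1.1: the concatenation («tour») inequality, arXiv:1708.00395v3 p. 13, unnumbered)] -/
theorem clsPt_mem {b : Bool} {k : ℕ} {y : HV} (hy : y ∈ rotTriV k) (h1 : y ≠ wOut) (h2 : y ≠ hvOrigin) :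
    clsPt b y ∈ rotTriV k ∧ clsPt b y ≠ wOut ∧ clsPt b y ≠ hvOrigin := by
  cases b
  · exact ⟨hy, h1, h2⟩
  · refine ⟨reflX_mem_rotTriV hy, fun h => h2 ?_, fun h => h1 ?_⟩
    · have := congrArg reflX h; rwa [clsPt, reflX_reflX, reflX_wOut] at this
    · have := congrArg reflX h; rwa [clsPt, reflX_reflX, reflX_hvOrigin] at this

/-- height of the exit vertex of a piece. [folklore] -/
def exitH (P : List HV) : ℤ := -xi (finalDart P).2
/-- **ray-edge index** of the exit: the exit vertex has height `3k + 1` or `3k + 2`. [cite: GlazmanManolescu2019, §4.1] -/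
def exitK (P : List HV) : ℕ := ((exitH P - 1) / 3).toNat
/-- arrival at the UPPER endpoint `u'_k` (height `3k + 2`) rather than the lower one `u_k` (`3k + 1`). [folklore] -/
def exitUp (P : List HV) : Bool := decide (exitH P % 3 = 2)

/-- `X ≢ 0 (mod 3)` for every vertex (`X = 3x₁ + b + 4`). [cite: GlazmanManolescu2019, §4.1 (proof of Proposition 1.1: the concatenation («tour») inequality, arXiv:1708.00395v3 p. 13, unnumbered)] -/
private theorem xX_mod_three (v : HV) : xX v % 3 = 1 ∨ xX v % 3 = 2 := by
  obtain ⟨a, b, c⟩ := v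
  cases c <;> simp [xX, bit]
  all_goals omega

/-- Adjacent vertices in the `(X, ξ)` model: a lattice edge changes `(ξ, X)` by `±(1, 1)`, `±(-1, 1)` or `±(0, 2)`. [cite: GlazmanManolescu2019, §4.1 (proof of Proposition 1.1: the concatenation («tour») inequality, arXiv:1708.00395v3 p. 13, unnumbered)] -/
private theorem adj_coord {u v : HV} (h : hvGraph.Adj u v) :
    (xi v = xi u + 1 ∧ xX v = xX u + 1) ∨ (xi v = xi u - 1 ∧ xX v = xX u + 1) ∨ (xi v = xi u ∧ xX v = xX u - 2) ∨
      (xi v = xi u - 1 ∧ xX v = xX u - 1) ∨ (xi v = xi u + 1 ∧ xX v = xX u - 1) ∨ (xi v = xi u ∧ xX v = xX u + 2) := by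
  obtain ⟨a, b, c⟩ := u
  obtain ⟨a', b', c'⟩ := v
  rw [hvGraph_adj] at h
  cases c <;> cases c' <;> simp [AdjRel, xi, xX, bit] at h ⊢ <;> omega

/-- Membership in the class-`b` pieces, unfolded: a mid-walk of `T_M ∖ {a⁻}` whose class-normalised exit vertex lies
on the LEFT side line `X = -6M - ξ`. [cite: GlazmanManolescu2019, §4.1] -/
theorem mem_rotSideWalks_iff {b : Bool} {M : ℕ} {P : List HV} :
    P ∈ rotSideWalks b M ↔ IsMidWalk ((rotTriV M).erase wOut) P ∧
      xX (clsPt b (finalDart P).2) = -(6 : ℤ) * M - xi (finalDart P).2 := by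
  cases b
  · simp only [rotSideWalks, rotSideWalksL, mem_filter, mem_midWalks_iff, IsRotSideL, clsPt]
  · simp only [rotSideWalks, rotSideWalksR, mem_filter, mem_midWalks_iff, IsRotSideR, clsPt, xX_reflX]
    constructor <;> rintro ⟨h1, h2⟩ <;> exact ⟨h1, by omega⟩

/-- **Anatomy of a piece.** A class-`b` piece of `T_k` is `a⁻ :: (l ++ [u])` with `l ≠ []` a self-avoiding lattice
path from `a⁺` inside `T_k ∖ {a⁻}`, whose last vertex is adjacent to the exit vertex `u ∉ T_k`; the exit height
`h = -ξ(u)` satisfies `1 ≤ h ≤ 6k + 2`, `h ≢ 0 (mod 3)`, and the class-normalised exit vertex lies on the left line.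
[cite: GlazmanManolescu2019, §4.1 (Δ^Δ_{L,K}, 0 ≤ K ≤ 2L)] -/
theorem rotSideWalks_anatomy {b : Bool} {k : ℕ} {P : List HV} (hP : P ∈ rotSideWalks b k) :
    ∃ (l : List HV) (u : HV) (hl : l ≠ []), P = wOut :: (l ++ [u]) ∧
      (l.IsChain hvGraph.Adj ∧ l.head? = some hvOrigin ∧ hvGraph.Adj (l.getLast hl) u ∧
        (∀ x ∈ l, x ∈ (rotTriV k).erase wOut) ∧ l.Nodup) ∧
      u ∉ rotTriV k ∧ xX (clsPt b u) = -(6 : ℤ) * k - xi u ∧ 1 ≤ -xi u ∧ -xi u ≤ 6 * k + 2 ∧ (-xi u) % 3 ≠ 0 ∧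
      finalDart P = (l.getLast hl, u) := by
  obtain ⟨hW, hline⟩ := mem_rotSideWalks_iff.1 hP
  rcases hW.trivial_or_exists with rfl | ⟨l, u, hl, rfl⟩
  · -- the trivial walk `[a⁻, a⁺]` exits nowhere: its final dart is `(a⁻, a⁺)`, and `a⁺` is on no side line
    exfalso
    have hfd : finalDart [wOut, hvOrigin] = (wOut, hvOrigin) := by decide
    rw [hfd] at hline
    dsimp only at hline
    cases b
    · rw [clsPt_false, xX_hvOrigin, xi_hvOrigin] at hline; omega
    · rw [xX_clsPt_true, xX_hvOrigin, xi_hvOrigin] at hline; omega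
  have hfd := finalDart_cons_append hl u
  rw [hfd] at hline
  dsimp only at hline
  obtain ⟨hc, hh, hadj, hV, hnd, -⟩ := (isMidWalk_cons_append_iff _ hl u).1 hW
  have he := hV _ (List.getLast_mem hl)
  rw [mem_erase] at he
  have hco := adj_coord hadj
  have hm3 := xX_mod_three u
  -- the side line through the ORIGINAL exit vertex: left (`X = -6k - ξ`) or right (`X = 6k + 6 + ξ`)
  have hlineU : xX u = -(6 : ℤ) * k - xi u ∨ xX u = 6 * k + 6 + xi u := by
    cases b
    · rw [clsPt_false] at hline; exact Or.inl hline
    · rw [xX_clsPt_true] at hline; exact Or.inr (by omega)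
  -- the last inner vertex: `a⁺` (on `ℓ`, `X = 4`) or an interior vertex of `T_k`
  have hewin : (xi (l.getLast hl) = 0 ∧ xX (l.getLast hl) = 4) ∨
      (1 ≤ -xi (l.getLast hl) ∧ -(6 : ℤ) * k - xi (l.getLast hl) < xX (l.getLast hl) ∧
        xX (l.getLast hl) < 6 * k + 6 + xi (l.getLast hl)) := by
    rcases mem_rotTriV_iff.1 he.2 with h | h | h
    · exact absurd h he.1
    · rw [h, xi_hvOrigin, xX_hvOrigin]; exact Or.inl ⟨rfl, rfl⟩
    · exact Or.inr h
  have hk : (0 : ℤ) ≤ k := Int.natCast_nonneg k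
  have hu1 : 1 ≤ -xi u := by omega
  have hu2 : -xi u ≤ 6 * k + 2 := by omega
  have hu3 : (-xi u) % 3 ≠ 0 := by omega
  refine ⟨l, u, hl, rfl, ⟨hc, hh, hadj, hV, hnd⟩, ?_, hline, hu1, hu2, hu3, hfd⟩
  -- `u ∉ T_k`: `a∓` lie on `ℓ`, and interior vertices satisfy the STRICT side inequalities
  intro hu
  rcases mem_rotTriV_iff.1 hu with h | h | ⟨h1, h2, h3⟩
  · rw [h, xi_wOut] at hu1; omega
  · rw [h, xi_hvOrigin] at hu1; omega
  · omega

/-- A piece has no repeated vertex at all (its exit vertex is outside `T_k ∋ a⁻`, and `a⁻` is not inner). [cite: GlazmanManolescu2019, §4.1 (proof of Proposition 1.1: the concatenation («tour») inequality, arXiv:1708.00395v3 p. 13, unnumbered)] -/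
theorem rotSideWalks_nodup {b : Bool} {k : ℕ} {P : List HV} (hP : P ∈ rotSideWalks b k) : P.Nodup := by
  obtain ⟨l, u, hl, rfl, ⟨-, -, -, hV, hnd⟩, hu, -, hu1, -⟩ := rotSideWalks_anatomy hP
  have hw : wOut ∉ l := fun h => (mem_erase.1 (hV _ h)).1 rfl
  have hul : u ∉ l := fun h => hu (mem_of_mem_erase (hV _ h))
  have huw : u ≠ wOut := fun h => by rw [h, xi_wOut] at hu1; omega
  refine List.nodup_cons.2 ⟨?_, ?_⟩
  · simp only [List.mem_append, List.mem_singleton, not_or]; exact ⟨hw, fun h => huw h.symm⟩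
  · exact hnd.append (List.nodup_singleton u) (fun x hx hx' => hul (by rw [List.mem_singleton.1 hx'] at hx; exact hx))

/-- A piece is a lattice path. [cite: GlazmanManolescu2019, §4.1 (proof of Proposition 1.1: the concatenation («tour») inequality, arXiv:1708.00395v3 p. 13, unnumbered)] -/
theorem rotSideWalks_isChain {b : Bool} {k : ℕ} {P : List HV} (hP : P ∈ rotSideWalks b k) : P.IsChain hvGraph.Adj :=
  ((mem_rotSideWalks_iff.1 hP).1).1

/-- The exit data in terms of the exit vertex. [cite: GlazmanManolescu2019, §4.1 (proof of Proposition 1.1: the concatenation («tour») inequality, arXiv:1708.00395v3 p. 13, unnumbered)] -/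
theorem exitH_eq (P : List HV) : exitH P = -xi (finalDart P).2 := rfl

/-- **The exit index is at most `2k`** (`0 ≤ K ≤ 2L`). [cite: GlazmanManolescu2019, §4.1] -/
theorem exitK_le {b : Bool} {k : ℕ} {P : List HV} (hP : P ∈ rotSideWalks b k) : exitK P ≤ 2 * k := by
  obtain ⟨l, u, hl, rfl, -, -, -, hu1, hu2, -, hfd⟩ := rotSideWalks_anatomy hP
  have : ((exitK (wOut :: (l ++ [u])) : ℕ) : ℤ) ≤ 2 * k := by
    rw [exitK, exitH, hfd]
    dsimp only
    rw [Int.toNat_of_nonneg (by omega)]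
    omega
  exact_mod_cast this

/-- **The class-normalised exit vertex IS a junction vertex**: `u_K = Φ₂(k,K)(a⁻)` (arrival low) or
`u'_K = Φ₂(k,K)(a⁺)` (arrival up), `K = exitK`. [cite: GlazmanManolescu2019, §4.1, lane ROUTES-G15 §2.3 S4] -/
theorem clsPt_exit_eq {b : Bool} {k : ℕ} {P : List HV} (hP : P ∈ rotSideWalks b k) :
    clsPt b (finalDart P).2 =
      bif exitUp P then rotPhi2 k (exitK P) hvOrigin else rotPhi2 k (exitK P) wOut := by
  obtain ⟨l, u, hl, rfl, -, -, hline, hu1, hu2, hu3, hfd⟩ := rotSideWalks_anatomy hP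
  have hK : ((exitK (wOut :: (l ++ [u])) : ℕ) : ℤ) = (-xi u - 1) / 3 := by
    rw [exitK, exitH, hfd]
    dsimp only
    rw [Int.toNat_of_nonneg (by omega)]
  rw [hfd]
  dsimp only
  have hline' : xX (clsPt b u) = -(6 : ℤ) * k - xi (clsPt b u) := by rw [xi_clsPt]; exact hline
  obtain ⟨j1, j2⟩ := eq_junction_of_leftLine (M := k) (k := exitK (wOut :: (l ++ [u]))) hline'
  cases hup : exitUp (wOut :: (l ++ [u]))
  · simp only [cond_false]
    have : exitH (wOut :: (l ++ [u])) % 3 ≠ 2 := by simpa [exitUp] using hup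
    rw [exitH, hfd] at this
    dsimp only at this
    exact j1 (by rw [xi_clsPt]; omega)
  · simp only [cond_true]
    have : exitH (wOut :: (l ++ [u])) % 3 = 2 := by simpa [exitUp] using hup
    rw [exitH, hfd] at this
    dsimp only at this
    exact j2 (by rw [xi_clsPt]; omega)

/-- Kernel sanity (M = 1, the r105 guard): the shortest left exit of `T_1` used in `tourEx1` is a class-`false`
piece with exit index `1`, arriving LOW; the one-step right exit of `T_0` is a class-`true` piece of `T_0` with
exit index `0`, whose exit `(X, h) = (5, 1)` has height `1 = 3·0 + 1`, so it arrives LOW too. [folklore] -/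
example : [((0 : ℤ), (-1 : ℤ), true), ((0 : ℤ), (0 : ℤ), false), ((-1 : ℤ), (0 : ℤ), true), ((-1 : ℤ), (0 : ℤ), false),
    ((-1 : ℤ), (-1 : ℤ), true), ((-1 : ℤ), (-1 : ℤ), false), ((-1 : ℤ), (-2 : ℤ), true), ((-1 : ℤ), (-2 : ℤ), false)]
      ∈ rotSideWalks false 1 ∧
    exitK [((0 : ℤ), (-1 : ℤ), true), ((0 : ℤ), (0 : ℤ), false), ((-1 : ℤ), (0 : ℤ), true), ((-1 : ℤ), (0 : ℤ), false),
      ((-1 : ℤ), (-1 : ℤ), true), ((-1 : ℤ), (-1 : ℤ), false), ((-1 : ℤ), (-2 : ℤ), true), ((-1 : ℤ), (-2 : ℤ), false)] = 1 ∧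
    exitUp [((0 : ℤ), (-1 : ℤ), true), ((0 : ℤ), (0 : ℤ), false), ((-1 : ℤ), (0 : ℤ), true), ((-1 : ℤ), (0 : ℤ), false),
      ((-1 : ℤ), (-1 : ℤ), true), ((-1 : ℤ), (-1 : ℤ), false), ((-1 : ℤ), (-2 : ℤ), true), ((-1 : ℤ), (-2 : ℤ), false)] = false ∧
    [wOut, hvOrigin, ((-1 : ℤ), (0 : ℤ), true)] ∈ rotSideWalks true 0 ∧ exitK [wOut, hvOrigin, ((-1 : ℤ), (0 : ℤ), true)] = 0 ∧
    exitUp [wOut, hvOrigin, ((-1 : ℤ), (0 : ℤ), true)] = false := by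
  refine ⟨?_, by decide, by decide, ?_, by decide, by decide⟩
  · rw [mem_rotSideWalks_iff]; exact ⟨by decide, by decide⟩
  · rw [mem_rotSideWalks_iff]; exact ⟨by decide, by decide⟩


/-! ### F2. Generic glue: continuing a lattice path through a junction -/

/-- `sameB up b`: the arrival endpoint flag equals the class flag of the next piece — then the junction is FREE
(`drop 1`: the next piece's placed start vertex IS the arrival vertex); otherwise the junction costs the ray edge
(`drop 2`). (lane note ROUTES-G16 §4.5, junction accounting) [folklore] -/
def sameB : Bool → Bool → Bool
  | true, true => true
  | false, false => true
  | true, false => false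
  | false, true => false

/-- The continuation segment contributed by a piece `P` placed by `f`: `P.map f` minus its first vertex (free
junction) or minus its first two vertices (ray-edge junction). [folklore] -/
def segOf (f : HV → HV) (j1 : Bool) (P : List HV) : List HV :=
  bif j1 then (P.map f).tail else (P.map f).tail.tail

/-- The vertex at which the previous piece must ARRIVE for `segOf f j1 P` to continue it. [folklore] -/
def arrOf (f : HV → HV) (j1 : Bool) : HV := bif j1 then f wOut else f hvOrigin

/-- A list with a known head is that head consed onto its tail. [cite: GlazmanManolescu2019, §4.1 (proof of Proposition 1.1: the concatenation («tour») inequality, arXiv:1708.00395v3 p. 13, unnumbered)] -/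
private theorem eq_cons_tail_of_head {l : List HV} {a : HV} (h : l.head? = some a) : l = a :: l.tail := by
  cases l with
  | nil => simp at h
  | cons b t => simp only [List.head?_cons, Option.some.injEq] at h; subst h; rfl

/-- Membership in the optional one-vertex junction segment. [cite: GlazmanManolescu2019, §4.1 (proof of Proposition 1.1: the concatenation («tour») inequality, arXiv:1708.00395v3 p. 13, unnumbered)] -/
private theorem mem_bif_singleton {c : Bool} {a z : HV} (h : z ∈ (bif c then [a] else ([] : List HV))) : z = a := by
  cases c <;> simp_all

/-- The optional junction segment has length at most one. [cite: GlazmanManolescu2019, §4.1 (proof of Proposition 1.1: the concatenation («tour») inequality, arXiv:1708.00395v3 p. 13, unnumbered)] -/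
private theorem length_bif_singleton_le (c : Bool) (a : HV) : (bif c then [a] else ([] : List HV)).length ≤ 1 := by
  cases c <;> simp

/-- **The placed piece.** For a piece `a⁻ :: (l ++ [u])` (`l = a⁺ :: l.tail`) placed by an injective
adjacency-preserving `f`: the segment is `[f a⁺]? ++ l.tail.map f ++ [f u]`, and `arrival :: segment` is a
self-avoiding lattice path (a suffix of the placed piece). [cite: GlazmanManolescu2019, §4.1 (proof of Proposition 1.1: the concatenation («tour») inequality, arXiv:1708.00395v3 p. 13, unnumbered)] -/
theorem segOf_spec {f : HV → HV} (hf : Function.Injective f)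
    (hfadj : ∀ ⦃x y : HV⦄, hvGraph.Adj x y → hvGraph.Adj (f x) (f y))
    {l : List HV} {u : HV} (hh : l.head? = some hvOrigin)
    (hc : (wOut :: (l ++ [u])).IsChain hvGraph.Adj) (hnd : (wOut :: (l ++ [u])).Nodup) (j1 : Bool) :
    segOf f j1 (wOut :: (l ++ [u])) = ((bif j1 then [f hvOrigin] else []) ++ l.tail.map f) ++ [f u] ∧
    (arrOf f j1 :: segOf f j1 (wOut :: (l ++ [u]))).IsChain hvGraph.Adj ∧
    (arrOf f j1 :: segOf f j1 (wOut :: (l ++ [u]))).Nodup := by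
  have hl' : l = hvOrigin :: l.tail := eq_cons_tail_of_head hh
  have hmap : (wOut :: (l ++ [u])).map f = f wOut :: f hvOrigin :: (l.tail.map f ++ [f u]) := by
    conv_lhs => rw [hl']
    simp
  have hcF : ((wOut :: (l ++ [u])).map f).IsChain hvGraph.Adj :=
    (List.isChain_map f).2 (hc.imp fun _ _ h => hfadj h)
  have hndF : ((wOut :: (l ++ [u])).map f).Nodup := hnd.map hf
  cases j1
  · have hseg : segOf f false (wOut :: (l ++ [u])) = l.tail.map f ++ [f u] := by
      rw [segOf, hmap]; rfl
    have harr : arrOf f false :: segOf f false (wOut :: (l ++ [u])) = ((wOut :: (l ++ [u])).map f).tail := by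
      rw [hseg, hmap]; rfl
    refine ⟨by rw [hseg]; simp, ?_, ?_⟩
    · rw [harr]; exact hcF.tail
    · rw [harr, hmap]; rw [hmap] at hndF; exact hndF.of_cons
  · have hseg : segOf f true (wOut :: (l ++ [u])) = f hvOrigin :: (l.tail.map f ++ [f u]) := by
      rw [segOf, hmap]; rfl
    have harr : arrOf f true :: segOf f true (wOut :: (l ++ [u])) = (wOut :: (l ++ [u])).map f := by
      rw [hseg, hmap]; rfl
    refine ⟨by rw [hseg]; simp, ?_, ?_⟩
    · rw [harr]; exact hcF
    · rw [harr]; exact hndF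

/-- Continuing a lattice path `S` ending at `a` by a lattice path `a :: T`: `S ++ T` is a lattice path. [cite: GlazmanManolescu2019, §4.1 (proof of Proposition 1.1: the concatenation («tour») inequality, arXiv:1708.00395v3 p. 13, unnumbered)] -/
theorem isChain_append_of_junction {S T : List HV} {a : HV} (hS : S.IsChain hvGraph.Adj)
    (hT : (a :: T).IsChain hvGraph.Adj) (hj : S.getLast? = some a) : (S ++ T).IsChain hvGraph.Adj := by
  refine hS.append hT.tail ?_
  intro x hx y hy
  have hx' : S.getLast? = some x := hx
  rw [hj, Option.some.injEq] at hx'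
  subst hx'
  exact (List.isChain_cons.1 hT).1 y hy

/-- The arrival vertex, for a next piece of class `b` placed by `Φ ∘ clsPt b`: the lower endpoint `Φ a⁻` after a
LOW arrival, the upper endpoint `Φ a⁺` after an UP arrival — for both classes. [cite: GlazmanManolescu2019, §4.1 (proof of Proposition 1.1, arXiv:1708.00395v3 p. 13: consecutive pieces meet on a ray), lane ROUTES-G15 §2.3 S4] -/
theorem arrOf_placeIso (Φ : hvGraph ≃g hvGraph) (up b : Bool) :
    arrOf (placeIso Φ b) (sameB up b) = bif up then Φ hvOrigin else Φ wOut := by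
  cases up <;> cases b <;>
    simp only [arrOf, sameB, cond_true, cond_false, placeIso_apply, clsPt_false, clsPt_wOut_true,
      clsPt_hvOrigin_true]


end Literature.Probability.RandomPlanarGeometry.SAW.HV

/-! ## Section: HexSAWRotTourGlue -/

namespace Literature.Probability.RandomPlanarGeometry.SAW.HV

/-! ### F3. The glued tour (frame `c₀`: piece 1 a LEFT exit of `T_M`) -/

/-- **The K95.4a tour as ONE explicit list** (frame `c₀`): piece 1 as it is; piece 2 (class `b₂`) placed at
ray-edge `exitK P₁` of the `60°`-ray by `Φ₂ ∘ clsPt b₂`; piece 3 (class `b₃`) placed at ray-edge `exitK P₂` of the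
`120°`-ray by `Φ₃ ∘ clsPt b₃`; each junction free or through its ray edge according to `sameB`.
[cite: GlazmanManolescu2019, §4.1 (proof of Proposition 1.1, arXiv:1708.00395v3 p. 13, Fig. 6), lane ROUTES-G15 §2.3 S4, lane ROUTES-G16 §4.4] -/
def rotTour (M : ℕ) (P₁ : List HV) (b₂ : Bool) (P₂ : List HV) (b₃ : Bool) (P₃ : List HV) : List HV :=
  P₁ ++ segOf (placeIso (rotPhi2 M (exitK P₁)) b₂) (sameB (exitUp P₁) b₂) P₂ ++
    segOf (placeIso (rotPhi3 M (exitK P₂)) b₃) (sameB (exitUp P₂) b₃) P₃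

/-- Kernel sanity: `tourEx1` and `tourEx2` of Part E ARE instances of `rotTour` (classes `L,L` resp. `L,Rmir`).
[folklore] -/
example : rotTour 1
    [((0 : ℤ), (-1 : ℤ), true), ((0 : ℤ), (0 : ℤ), false), ((-1 : ℤ), (0 : ℤ), true), ((-1 : ℤ), (0 : ℤ), false),
      ((-1 : ℤ), (-1 : ℤ), true), ((-1 : ℤ), (-1 : ℤ), false), ((-1 : ℤ), (-2 : ℤ), true), ((-1 : ℤ), (-2 : ℤ), false)]
    false
    [((0 : ℤ), (-1 : ℤ), true), ((0 : ℤ), (0 : ℤ), false), ((-1 : ℤ), (0 : ℤ), true), ((-1 : ℤ), (0 : ℤ), false),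
      ((-1 : ℤ), (-1 : ℤ), true), ((-1 : ℤ), (-1 : ℤ), false), ((-1 : ℤ), (-2 : ℤ), true), ((-1 : ℤ), (-2 : ℤ), false)]
    false
    [((0 : ℤ), (-1 : ℤ), true), ((0 : ℤ), (0 : ℤ), false), ((-1 : ℤ), (0 : ℤ), true), ((-1 : ℤ), (0 : ℤ), false),
      ((-1 : ℤ), (-1 : ℤ), true), ((-1 : ℤ), (-1 : ℤ), false), ((-1 : ℤ), (-2 : ℤ), true), ((-1 : ℤ), (-2 : ℤ), false)] =
    tourEx1 ∧
  rotTour 1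
    [((0 : ℤ), (-1 : ℤ), true), ((0 : ℤ), (0 : ℤ), false), ((-1 : ℤ), (0 : ℤ), true), ((-1 : ℤ), (0 : ℤ), false),
      ((-1 : ℤ), (-1 : ℤ), true), ((-1 : ℤ), (-1 : ℤ), false), ((-1 : ℤ), (-2 : ℤ), true), ((-1 : ℤ), (-2 : ℤ), false)]
    false
    [((0 : ℤ), (-1 : ℤ), true), ((0 : ℤ), (0 : ℤ), false), ((-1 : ℤ), (0 : ℤ), true), ((-1 : ℤ), (0 : ℤ), false),
      ((-1 : ℤ), (-1 : ℤ), true), ((-1 : ℤ), (-1 : ℤ), false), ((-1 : ℤ), (-2 : ℤ), true), ((0 : ℤ), (-2 : ℤ), false),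
      ((0 : ℤ), (-3 : ℤ), true)]
    true [((0 : ℤ), (-1 : ℤ), true), ((0 : ℤ), (0 : ℤ), false), ((-1 : ℤ), (0 : ℤ), true)] = tourEx2 := by
  constructor <;> decide

/-- **THE GLUING THEOREM (frame `c₀`).** For `M ≥ 1`, `H, W ≥ 28M`, a left-exiting piece `P₁` of `T_M`, a piece
`P₂` of class `b₂` of `T_{exitK P₁}` and a piece `P₃` of class `b₃` of `T_{exitK P₂}`, the glued list `rotTour` is a
right-started self-avoiding mid-walk of Beaton's domain `D(H, W) ∖ {a⁻}` whose final dart is a bottom exit in the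
window of block `M`, of length at most `ℓ(P₁) + ℓ(P₂) + ℓ(P₃) + 2` (the two possible ray edges).  This is the
walk-level content of `RotTourKeyIneq` (K95.4a); the weighted inequality follows by summing over the decoded
image (T4/T6). [cite: GlazmanManolescu2019, §4.1 (proof of Proposition 1.1: the concatenation («tour») inequality, arXiv:1708.00395v3 p. 13, unnumbered), lane ROUTES-G16 §4.4–4.5] -/
theorem rotTour_spec {M H Wd : ℕ} (hM : 1 ≤ M) (hH : 28 * M ≤ H) (hW : 28 * M ≤ Wd)
    {P₁ P₂ P₃ : List HV} {b₂ b₃ : Bool} (h₁ : P₁ ∈ rotSideWalks false M)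
    (h₂ : P₂ ∈ rotSideWalks b₂ (exitK P₁)) (h₃ : P₃ ∈ rotSideWalks b₃ (exitK P₂)) :
    IsMidWalk ((rotStripV H Wd).erase wOut) (rotTour M P₁ b₂ P₂ b₃ P₃) ∧
      IsRotBotWin M (finalDart (rotTour M P₁ b₂ P₂ b₃ P₃)) ∧
      mwLen (rotTour M P₁ b₂ P₂ b₃ P₃) ≤ mwLen P₁ + mwLen P₂ + mwLen P₃ + 2 := by
  -- names for the frame data (atoms for `omega`), introduced before anything is derived from `h₂`, `h₃`
  have hK : exitK P₁ ≤ 2 * M := exitK_le h₁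
  obtain ⟨K, hKe⟩ : ∃ K, K = exitK P₁ := ⟨_, rfl⟩
  obtain ⟨up₁, hupe₁⟩ : ∃ b, b = exitUp P₁ := ⟨_, rfl⟩
  rw [← hKe] at h₂ hK
  have hK' : exitK P₂ ≤ 2 * K := exitK_le h₂
  obtain ⟨K', hKe'⟩ : ∃ K', K' = exitK P₂ := ⟨_, rfl⟩
  obtain ⟨up₂, hupe₂⟩ : ∃ b, b = exitUp P₂ := ⟨_, rfl⟩
  rw [← hKe'] at h₃ hK'
  have hK4 : K ≤ 4 * M := by omega
  have hK'4 : K' ≤ 4 * M := by omega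
  -- the exit identities and the path facts, before destructuring the pieces
  have hex₁ := clsPt_exit_eq h₁
  rw [← hKe, ← hupe₁] at hex₁
  have hex₂ := clsPt_exit_eq h₂
  rw [← hKe', ← hupe₂] at hex₂
  have hndP₁ := rotSideWalks_nodup h₁
  have hndP₂ := rotSideWalks_nodup h₂
  have hndP₃ := rotSideWalks_nodup h₃
  have hcP₁ := rotSideWalks_isChain h₁
  have hcP₂ := rotSideWalks_isChain h₂
  have hcP₃ := rotSideWalks_isChain h₃
  obtain ⟨l₁, u₁, hl₁, hP₁, ⟨-, hh₁, -, hV₁, hnd₁⟩, -, hline₁, hu₁a, -, -, hfd₁⟩ := rotSideWalks_anatomy h₁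
  obtain ⟨l₂, u₂, hl₂, hP₂, ⟨-, hh₂, -, hV₂, hnd₂⟩, -, hline₂, hu₂a, -, -, hfd₂⟩ := rotSideWalks_anatomy h₂
  obtain ⟨l₃, u₃, hl₃, hP₃, ⟨-, hh₃, -, hV₃, hnd₃⟩, -, hline₃, hu₃a, hu₃b, -, hfd₃⟩ := rotSideWalks_anatomy h₃
  have hG : rotTour M P₁ b₂ P₂ b₃ P₃ = P₁ ++ segOf (placeIso (rotPhi2 M K) b₂) (sameB up₁ b₂) P₂ ++
      segOf (placeIso (rotPhi3 M K') b₃) (sameB up₂ b₃) P₃ := by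
    rw [rotTour, hKe, hKe', hupe₁, hupe₂]
  rw [hG]
  -- the two placements
  obtain ⟨ψ₂, hψ₂⟩ : ∃ ψ : hvGraph ≃g hvGraph, ψ = placeIso (rotPhi2 M K) b₂ := ⟨_, rfl⟩
  obtain ⟨ψ₃, hψ₃⟩ : ∃ ψ : hvGraph ≃g hvGraph, ψ = placeIso (rotPhi3 M K') b₃ := ⟨_, rfl⟩
  rw [← hψ₂, ← hψ₃]
  have hψ₂a : ∀ v, ψ₂ v = rotPhi2 M K (clsPt b₂ v) := fun v => by rw [hψ₂, placeIso_apply]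
  have hψ₃a : ∀ v, ψ₃ v = rotPhi3 M K' (clsPt b₃ v) := fun v => by rw [hψ₃, placeIso_apply]
  obtain ⟨hseg₂, hcF₂, hndF₂⟩ := segOf_spec ψ₂.injective (fun x y h => ψ₂.map_adj_iff.2 h) hh₂
    (by rw [← hP₂]; exact hcP₂) (by rw [← hP₂]; exact hndP₂) (sameB up₁ b₂)
  obtain ⟨hseg₃, hcF₃, hndF₃⟩ := segOf_spec ψ₃.injective (fun x y h => ψ₃.map_adj_iff.2 h) hh₃
    (by rw [← hP₃]; exact hcP₃) (by rw [← hP₃]; exact hndP₃) (sameB up₂ b₃)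
  rw [← hP₂] at hseg₂ hcF₂ hndF₂
  rw [← hP₃] at hseg₃ hcF₃ hndF₃
  -- abbreviations for the two segments
  obtain ⟨S₂, hS₂⟩ : ∃ S, S = segOf ψ₂ (sameB up₁ b₂) P₂ := ⟨_, rfl⟩
  obtain ⟨S₃, hS₃⟩ : ∃ S, S = segOf ψ₃ (sameB up₂ b₃) P₃ := ⟨_, rfl⟩
  rw [← hS₂] at hseg₂ hcF₂ hndF₂ ⊢
  rw [← hS₃] at hseg₃ hcF₃ hndF₃ ⊢
  -- JUNCTION 1: piece 1 arrives exactly where `arrival₂ :: S₂` starts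
  have harr₂ : arrOf ψ₂ (sameB up₁ b₂) = u₁ := by
    rw [hψ₂, arrOf_placeIso]
    rw [hfd₁] at hex₁
    dsimp only at hex₁
    rw [clsPt_false] at hex₁
    exact hex₁.symm
  -- JUNCTION 2: piece 2's placed exit vertex is where `arrival₃ :: S₃` starts (cocycle Φ₂(M,K) ∘ Φ₂(K,K') = Φ₃(M,K'))
  have harr₃ : arrOf ψ₃ (sameB up₂ b₃) = ψ₂ u₂ := by
    rw [hψ₃, arrOf_placeIso, hψ₂a]
    rw [hfd₂] at hex₂
    dsimp only at hex₂
    rw [hex₂]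
    cases up₂
    · simp only [cond_false]; exact (rotPhi2_rotPhi2 M K K' wOut).symm
    · simp only [cond_true]; exact (rotPhi2_rotPhi2 M K K' hvOrigin).symm
  -- coordinates of the junction vertices and of the landing vertex
  have cu₁ : 1 ≤ -xi u₁ ∧ xX u₁ + 6 * M = -xi u₁ := by rw [clsPt_false] at hline₁; exact ⟨hu₁a, by omega⟩
  have cψ₂O : 1 ≤ -xi (ψ₂ hvOrigin) ∧ xX (ψ₂ hvOrigin) + 6 * M = -xi (ψ₂ hvOrigin) := by
    rw [hψ₂a]
    obtain ⟨a1, a2⟩ := rotPhi2_wOut_coords M K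
    obtain ⟨b1, b2⟩ := rotPhi2_hvOrigin_coords M K
    cases b₂
    · rw [clsPt_false]; constructor <;> omega
    · rw [clsPt_hvOrigin_true]; constructor <;> omega
  have cψ₂u₂ : 1 ≤ -xi (ψ₂ u₂) ∧ xX (ψ₂ u₂) + 6 * M = xi (ψ₂ u₂) := by
    rw [← harr₃, hψ₃, arrOf_placeIso]
    obtain ⟨⟨c1, c2⟩, ⟨d1, d2⟩⟩ := rotPhi3_base_coords M K'
    cases up₂
    · simp only [cond_false]; constructor <;> omega
    · simp only [cond_true]; constructor <;> omega
  have cψ₃O : 1 ≤ -xi (ψ₃ hvOrigin) ∧ xX (ψ₃ hvOrigin) + 6 * M = xi (ψ₃ hvOrigin) := by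
    rw [hψ₃a]
    obtain ⟨⟨c1, c2⟩, ⟨d1, d2⟩⟩ := rotPhi3_base_coords M K'
    cases b₃
    · rw [clsPt_false]; constructor <;> omega
    · rw [clsPt_hvOrigin_true]; constructor <;> omega
  have hline₃' : xX (clsPt b₃ u₃) = -(6 : ℤ) * K' - xi (clsPt b₃ u₃) := by rw [xi_clsPt]; exact hline₃
  have cx₃ : xi (ψ₃ u₃) = 0 ∧ xX (ψ₃ u₃) = -(6 : ℤ) * M + 2 * xi u₃ := by
    rw [hψ₃a]
    have := rotPhi3_leftLine (M := M) hline₃'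
    rwa [xi_clsPt] at this
  have hwin : 6 * (M : ℤ) ≤ |xX (ψ₃ u₃) - 3| ∧ |xX (ψ₃ u₃) - 3| < 120 * M := by
    rw [hψ₃a]
    exact rotPhi3_window hM hK'4 hline₃' (by rw [xi_clsPt]; exact hu₃a) (by rw [xi_clsPt]; exact hu₃b)
  -- placed interior vertices: sectors Σ₂, Σ₃ and the big strip
  have hl₂' : l₂ = hvOrigin :: l₂.tail := eq_cons_tail_of_head hh₂
  have hl₃' : l₃ = hvOrigin :: l₃.tail := eq_cons_tail_of_head hh₃
  have hnd₂' : (hvOrigin :: l₂.tail).Nodup := by rw [← hl₂']; exact hnd₂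
  have hnd₃' : (hvOrigin :: l₃.tail).Nodup := by rw [← hl₃']; exact hnd₃
  have htail₂ : ∀ y ∈ l₂.tail, y ∈ rotTriV K ∧ y ≠ wOut ∧ y ≠ hvOrigin := by
    intro y hy
    have hyl : y ∈ l₂ := by rw [hl₂']; exact List.mem_cons_of_mem _ hy
    have hy' := mem_erase.1 (hV₂ y hyl)
    have hO : hvOrigin ∉ l₂.tail := (List.nodup_cons.1 hnd₂').1
    exact ⟨hy'.2, hy'.1, fun h => hO (h ▸ hy)⟩
  have htail₃ : ∀ y ∈ l₃.tail, y ∈ rotTriV K' ∧ y ≠ wOut ∧ y ≠ hvOrigin := by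
    intro y hy
    have hyl : y ∈ l₃ := by rw [hl₃']; exact List.mem_cons_of_mem _ hy
    have hy' := mem_erase.1 (hV₃ y hyl)
    have hO : hvOrigin ∉ l₃.tail := (List.nodup_cons.1 hnd₃').1
    exact ⟨hy'.2, hy'.1, fun h => hO (h ▸ hy)⟩
  have cmid₂ : ∀ y ∈ l₂.tail, InSector2 M (ψ₂ y) ∧ ψ₂ y ∈ rotStripV H Wd := by
    intro y hy
    obtain ⟨m1, m2, m3⟩ := clsPt_mem (b := b₂) (htail₂ y hy).1 (htail₂ y hy).2.1 (htail₂ y hy).2.2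
    rw [hψ₂a]
    exact ⟨(inSector2_rotPhi2 m1 m2 m3).1, rotPhi2_mem_rotStripV hM hK hH hW m1 m2 m3⟩
  have cmid₃ : ∀ y ∈ l₃.tail, InSector3 M (ψ₃ y) ∧ ψ₃ y ∈ rotStripV H Wd := by
    intro y hy
    obtain ⟨m1, m2, m3⟩ := clsPt_mem (b := b₃) (htail₃ y hy).1 (htail₃ y hy).2.1 (htail₃ y hy).2.2
    rw [hψ₃a]
    exact ⟨(inSector3_rotPhi3 m1 m2 m3).1, rotPhi3_mem_rotStripV hM hK'4 hH hW m1 m2 m3⟩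
  have hjunc := junction_mem_rotStripV (H := H) (Wd := Wd) hM hK4 hH hW
  have hjunc' := junction_mem_rotStripV (H := H) (Wd := Wd) hM hK'4 hH hW
  have mψ₂O : ψ₂ hvOrigin ∈ rotStripV H Wd := by
    rw [hψ₂a]; cases b₂
    · rw [clsPt_false]; exact hjunc.2.1
    · rw [clsPt_hvOrigin_true]; exact hjunc.1
  have mψ₃O : ψ₃ hvOrigin ∈ rotStripV H Wd := by
    rw [hψ₃a]; cases b₃
    · rw [clsPt_false]; exact hjunc'.2.2.2
    · rw [clsPt_hvOrigin_true]; exact hjunc'.2.2.1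
  have mψ₂u₂ : ψ₂ u₂ ∈ rotStripV H Wd := by
    rw [← harr₃, hψ₃, arrOf_placeIso]
    cases up₂
    · exact hjunc'.2.2.1
    · exact hjunc'.2.2.2
  have mu₁ : u₁ ∈ rotStripV H Wd := by
    rw [← harr₂, hψ₂, arrOf_placeIso]
    cases up₁
    · exact hjunc.1
    · exact hjunc.2.1
  -- ZONES.  Segment 2: every vertex has `h ≥ 1` and `|X + 6M| ≤ h`, and only its last vertex `ψ₂ u₂` reaches `X + 6M = -h`.
  have Z₂ : ∀ z ∈ S₂, (1 ≤ -xi z ∧ xX z + 6 * M ≤ -xi z) ∧ (z = ψ₂ u₂ ∨ -(xX z + 6 * M) < -xi z) ∧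
      z ∈ rotStripV H Wd := by
    intro z hz
    rw [hseg₂] at hz
    simp only [List.mem_append, List.mem_map, List.mem_singleton] at hz
    rcases hz with (hz | ⟨y, hy, rfl⟩) | rfl
    · have := mem_bif_singleton hz; subst this
      exact ⟨⟨cψ₂O.1, by omega⟩, Or.inr (by omega), mψ₂O⟩
    · obtain ⟨⟨s1, s2⟩, sm⟩ := cmid₂ y hy
      have := abs_lt.1 s2
      exact ⟨⟨s1, by omega⟩, Or.inr (by omega), sm⟩
    · exact ⟨⟨cψ₂u₂.1, by omega⟩, Or.inl rfl, mψ₂u₂⟩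
  -- Segment 3 minus its last vertex: `h ≥ 1` and `X + 6M ≤ -h`; its last vertex is the landing vertex on `ℓ`.
  obtain ⟨R₃, hR₃⟩ : ∃ R, R = (bif sameB up₂ b₃ then [ψ₃ hvOrigin] else []) ++ l₃.tail.map ψ₃ := ⟨_, rfl⟩
  rw [← hR₃] at hseg₃
  have Z₃ : ∀ z ∈ R₃, (1 ≤ -xi z ∧ xX z + 6 * M ≤ xi z) ∧ z ∈ rotStripV H Wd := by
    intro z hz
    rw [hR₃] at hz
    simp only [List.mem_append, List.mem_map] at hz
    rcases hz with hz | ⟨y, hy, rfl⟩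
    · have := mem_bif_singleton hz; subst this
      exact ⟨⟨cψ₃O.1, by omega⟩, mψ₃O⟩
    · obtain ⟨⟨s1, s2⟩, sm⟩ := cmid₃ y hy
      exact ⟨⟨s1, by omega⟩, sm⟩
  -- Piece 1's inner vertices: `a⁺` or in `Σ₁`.
  have Z₁ : ∀ x ∈ l₁, ((xi x = 0 ∧ xX x = 4) ∨ (1 ≤ -xi x ∧ -xi x < xX x + 6 * M)) ∧ x ≠ wOut ∧
      x ∈ rotStripV H Wd := by
    intro x hx
    have hx' := mem_erase.1 (hV₁ x hx)
    refine ⟨?_, hx'.1, rotTriV_subset_rotStripV (M := M) (H := H) (Wd := Wd) (by omega) (by omega) hx'.2⟩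
    rcases mem_rotTriV_iff.1 hx'.2 with h | h | ⟨a1, a2, -⟩
    · exact absurd h hx'.1
    · rw [h, xi_hvOrigin, xX_hvOrigin]; exact Or.inl ⟨rfl, rfl⟩
    · exact Or.inr ⟨a1, by omega⟩
  -- THE GLUED LIST as `a⁻ :: (m ++ [x₃])`
  have hS₂ne : S₂ ≠ [] := by rw [hseg₂]; simp
  obtain ⟨m, hm⟩ : ∃ m, m = (l₁ ++ [u₁]) ++ S₂ ++ R₃ := ⟨_, rfl⟩
  have hGm : P₁ ++ S₂ ++ S₃ = wOut :: (m ++ [ψ₃ u₃]) := by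
    rw [hP₁, hseg₃, hm]; simp
  have hmne : m ≠ [] := by rw [hm]; simp
  rw [hGm]
  -- membership in `m`
  have hmem : ∀ v ∈ m, v ∈ l₁ ∨ v = u₁ ∨ v ∈ S₂ ∨ v ∈ R₃ := by
    intro v hv
    rw [hm] at hv
    simp only [List.mem_append, List.mem_singleton] at hv
    rcases hv with ((hv | hv) | hv) | hv
    · exact Or.inl hv
    · exact Or.inr (Or.inl hv)
    · exact Or.inr (Or.inr (Or.inl hv))
    · exact Or.inr (Or.inr (Or.inr hv))
  -- CHAIN
  have hj₁ : P₁.getLast? = some (arrOf ψ₂ (sameB up₁ b₂)) := by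
    rw [harr₂, hP₁, List.getLast?_eq_some_getLast (List.cons_ne_nil _ _)]; simp
  have hc12 : (P₁ ++ S₂).IsChain hvGraph.Adj := isChain_append_of_junction hcP₁ hcF₂ hj₁
  have hj₂ : (P₁ ++ S₂).getLast? = some (arrOf ψ₃ (sameB up₂ b₃)) := by
    rw [harr₃, hseg₂, hP₁, List.getLast?_eq_some_getLast (by simp)]; simp
  have hcG : (wOut :: (m ++ [ψ₃ u₃])).IsChain hvGraph.Adj := by
    rw [← hGm]
    exact isChain_append_of_junction hc12 hcF₃ hj₂
  -- NODUP
  have hndS₂ : S₂.Nodup := hndF₂.of_cons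
  have hndS₃ : S₃.Nodup := hndF₃.of_cons
  have hu₁S₂ : u₁ ∉ S₂ := fun h => (List.nodup_cons.1 hndF₂).1 (harr₂ ▸ h)
  have hψu₂S₃ : ψ₂ u₂ ∉ S₃ := fun h => (List.nodup_cons.1 hndF₃).1 (harr₃ ▸ h)
  have hnd12 : (P₁ ++ S₂).Nodup := by
    refine List.nodup_append'.2 ⟨hndP₁, hndS₂, ?_⟩
    intro v hv1 hv2
    rw [hP₁] at hv1
    simp only [List.mem_cons, List.mem_append, List.not_mem_nil, or_false] at hv1
    obtain ⟨⟨z1, z2⟩, -, -⟩ := Z₂ v hv2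
    rcases hv1 with rfl | hv1 | rfl
    · rw [xi_wOut] at z1; omega
    · obtain ⟨hx | hx, -, -⟩ := Z₁ v hv1 <;> omega
    · exact hu₁S₂ hv2
  have hndG : (wOut :: (m ++ [ψ₃ u₃])).Nodup := by
    rw [← hGm]
    refine List.nodup_append'.2 ⟨hnd12, hndS₃, ?_⟩
    intro v hv1 hv2
    have hv2' : v ∈ R₃ ∨ v = ψ₃ u₃ := by
      rw [hseg₃] at hv2; simpa only [List.mem_append, List.mem_singleton] using hv2
    -- `v` on the left: either the arrival vertex `ψ₂ u₂` (not in `S₃` by self-avoidance of piece 3) or in the zone `X + 6M > -h ∨ h = 0, X ≥ 2`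
    by_cases hva : v = ψ₂ u₂
    · exact hψu₂S₃ (hva ▸ hv2)
    have hzone : (xi v = 0 ∧ 2 ≤ xX v) ∨ (1 ≤ -xi v ∧ -(xX v + 6 * M) < -xi v) := by
      rw [hP₁] at hv1
      simp only [List.mem_append, List.mem_cons, List.not_mem_nil, or_false] at hv1
      rcases hv1 with (rfl | hv1 | rfl) | hv1
      · rw [xi_wOut, xX_wOut]; exact Or.inl ⟨rfl, by norm_num⟩
      · obtain ⟨hx | hx, -, -⟩ := Z₁ v hv1
        · exact Or.inl ⟨hx.1, by omega⟩
        · exact Or.inr ⟨hx.1, by omega⟩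
      · exact Or.inr ⟨cu₁.1, by omega⟩
      · obtain ⟨⟨z1, z2⟩, hz | hz, -⟩ := Z₂ v hv1
        · exact absurd hz hva
        · exact Or.inr ⟨z1, hz⟩
    rcases hv2' with hv2' | rfl
    · obtain ⟨⟨z1, z2⟩, -⟩ := Z₃ v hv2'
      rcases hzone with ⟨h0, -⟩ | ⟨h1, h2⟩ <;> omega
    · have hM' : (1 : ℤ) ≤ M := by exact_mod_cast hM
      rcases hzone with ⟨-, h0⟩ | ⟨h1, -⟩
      · rw [cx₃.2] at h0; omega
      · rw [cx₃.1] at h1; omega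
  -- consequences of NODUP for the mid-walk clauses
  have hndm : m.Nodup := (List.nodup_append'.1 (List.nodup_cons.1 hndG).2).1
  have hx₃m : ψ₃ u₃ ∉ m := fun h =>
    (List.nodup_append'.1 (List.nodup_cons.1 hndG).2).2.2 h (List.mem_singleton_self _)
  have hx₃w : ψ₃ u₃ ≠ wOut := fun h => by
    have := cx₃.2; rw [h, xX_wOut] at this; omega
  -- THE MID-WALK PROPERTY
  have hmid : IsMidWalk ((rotStripV H Wd).erase wOut) (wOut :: (m ++ [ψ₃ u₃])) := by
    have hmc := List.isChain_append.1 hcG.tail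
    refine (isMidWalk_cons_append_iff _ hmne (ψ₃ u₃)).2 ⟨hmc.1, ?_, ?_, ?_, hndm, ?_⟩
    · rw [hm, eq_cons_tail_of_head hh₁]; rfl
    · exact hmc.2.2 _ (by rw [List.getLast?_eq_some_getLast hmne]; rfl) _ rfl
    · intro x hx
      rw [mem_erase]
      rcases hmem x hx with hx | rfl | hx | hx
      · exact ⟨(Z₁ x hx).2.1, (Z₁ x hx).2.2⟩
      · exact ⟨fun h => by rw [h, xi_wOut] at cu₁; omega, mu₁⟩
      · obtain ⟨⟨z1, -⟩, -, zm⟩ := Z₂ x hx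
        exact ⟨fun h => by rw [h, xi_wOut] at z1; omega, zm⟩
      · obtain ⟨⟨z1, -⟩, zm⟩ := Z₃ x hx
        exact ⟨fun h => by rw [h, xi_wOut] at z1; omega, zm⟩
    · intro h
      rcases prevOf_mem m with h' | h'
      · exact hx₃w (h.trans h')
      · exact hx₃m (h ▸ h')
  refine ⟨hmid, ?_, ?_⟩
  · -- THE FINAL DART: a bottom exit `(p, x₃)` in the window of block `M`
    rw [finalDart_cons_append hmne]
    have hmc := List.isChain_append.1 hcG.tail
    have hadj : hvGraph.Adj (m.getLast hmne) (ψ₃ u₃) :=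
      hmc.2.2 _ (by rw [List.getLast?_eq_some_getLast hmne]; rfl) _ rfl
    obtain ⟨p, hp⟩ : ∃ p, p = m.getLast hmne := ⟨_, rfl⟩
    rw [← hp] at hadj ⊢
    have hpm : p ∈ m := hp ▸ List.getLast_mem hmne
    have hco := adj_coord hadj
    have hM' : (1 : ℤ) ≤ M := by exact_mod_cast hM
    -- `p` has height exactly 1 (it is adjacent to `x₃ ∈ ℓ`, and every vertex of `m` off `ℓ` has `h ≥ 1`; the `ℓ`-vertices `a⁺ ∈ m` has `X = 4`, too far)
    have hxp : xi p = -1 ∧ (xX p = xX (ψ₃ u₃) + 1 ∨ xX p = xX (ψ₃ u₃) - 1) := by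
      have cx := cx₃
      rcases hmem p hpm with hx | rfl | hx | hx
      · obtain ⟨hx | hx, -, -⟩ := Z₁ p hx <;> omega
      · omega
      · obtain ⟨⟨z1, z2⟩, -, -⟩ := Z₂ p hx; omega
      · obtain ⟨⟨z1, z2⟩, -⟩ := Z₃ p hx; omega
    have hx₃O : ψ₃ u₃ ≠ hvOrigin := fun h => by have := cx₃.2; rw [h, xX_hvOrigin] at this; omega
    have habs1 : |xX p - 3| = -(xX p - 3) := abs_of_neg (by have := cx₃.2; omega)
    have habs2 : |xX (ψ₃ u₃) - 3| = -(xX (ψ₃ u₃) - 3) := abs_of_neg (by have := cx₃.2; omega)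
    refine ⟨?_, hwin.1, hwin.2⟩
    have hbot : IsRotBotDart (p, ψ₃ u₃) := ⟨hxp.1, cx₃.1, hx₃O, hx₃w⟩
    rcases hxp.2 with h | h
    · left; refine ⟨hbot, ?_⟩; dsimp only; rw [habs1, habs2]; omega
    · right; refine ⟨hbot, ?_⟩; dsimp only; rw [habs1, habs2]; omega
  · -- THE LENGTH: `ℓ(G) = ℓ(P₁) + ℓ(P₂) + ℓ(P₃) + [junction 1 free] + [junction 2 free] ≤ … + 2`
    rw [mwLen_cons_append, hP₁, hP₂, hP₃, mwLen_cons_append, mwLen_cons_append, mwLen_cons_append, hm, hseg₂, hR₃]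
    have e₂ := congrArg List.length hl₂'
    have e₃ := congrArg List.length hl₃'
    simp only [List.length_cons] at e₂ e₃
    have b2 := length_bif_singleton_le (sameB up₁ b₂) (ψ₂ hvOrigin)
    have b3 := length_bif_singleton_le (sameB up₂ b₃) (ψ₃ hvOrigin)
    simp only [List.length_append, List.length_map, List.length_singleton]
    omega


end Literature.Probability.RandomPlanarGeometry.SAW.HV

/-! ## Section: HexSAWRotTourMirror -/

namespace Literature.Probability.RandomPlanarGeometry.SAW.HV

/-! ### G1. The outer class map of a frame -/

/-- The outer class map of frame `c_b` as a lattice automorphism: identity (`c₀`) or the mirror `reflX` (`c₁`). [folklore] -/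
def mirIso : Bool → (hvGraph ≃g hvGraph)
  | false => RelIso.refl _
  | true => reflX

/-- The frame map acts by `clsPt`. [cite: GlazmanManolescu2019, §4.1 (proof of Proposition 1.1: the concatenation («tour») inequality, arXiv:1708.00395v3 p. 13, unnumbered)] -/
@[simp] theorem mirIso_apply (b : Bool) (v : HV) : mirIso b v = clsPt b v := by cases b <;> rfl

/-- `clsPt b` is an involution. [cite: GlazmanManolescu2019, §4.1 (proof of Proposition 1.1: the concatenation («tour») inequality, arXiv:1708.00395v3 p. 13, unnumbered)] -/
@[simp] theorem clsPt_clsPt (b : Bool) (v : HV) : clsPt b (clsPt b v) = v := by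
  cases b
  · rfl
  · exact reflX_reflX v

/-- The class-normalised `a⁻` has abscissa in `[2, 4]`. [cite: GlazmanManolescu2019, §4.1 (proof of Proposition 1.1: the concatenation («tour») inequality, arXiv:1708.00395v3 p. 13, unnumbered)] -/
theorem xX_clsPt_wOut_bounds (b : Bool) : 2 ≤ xX (clsPt b wOut) ∧ xX (clsPt b wOut) ≤ 4 := by
  cases b
  · rw [clsPt_false, xX_wOut]; norm_num
  · rw [clsPt_wOut_true, xX_hvOrigin]; norm_num

/-- The class-normalised `a⁺` has abscissa in `[2, 4]`. [cite: GlazmanManolescu2019, §4.1 (proof of Proposition 1.1: the concatenation («tour») inequality, arXiv:1708.00395v3 p. 13, unnumbered)] -/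
theorem xX_clsPt_hvOrigin_bounds (b : Bool) : 2 ≤ xX (clsPt b hvOrigin) ∧ xX (clsPt b hvOrigin) ≤ 4 := by
  cases b
  · rw [clsPt_false, xX_hvOrigin]; norm_num
  · rw [clsPt_hvOrigin_true, xX_wOut]; norm_num

/-- `|Y − 3| = |X − 3|`: the distance from the axis `X = 3` of `ℓ` is mirror-invariant. [cite: GlazmanManolescu2019, §4.1 (proof of Proposition 1.1: the concatenation («tour») inequality, arXiv:1708.00395v3 p. 13, unnumbered)] -/
theorem abs_clsPt (b : Bool) (v : HV) : |xX (clsPt b v) - 3| = |xX v - 3| := by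
  cases b
  · rw [clsPt_false]
  · rw [xX_clsPt_true, show (6 : ℤ) - xX v - 3 = -(xX v - 3) by ring, abs_neg]

/-- Beaton's domain `D(H, W)` is invariant under the class normalisation (mirror symmetry). [cite: GlazmanManolescu2019, §4.1 (proof of Proposition 1.1: the concatenation («tour») inequality, arXiv:1708.00395v3 p. 13, unnumbered)] -/
theorem clsPt_mem_rotStripV (b : Bool) {H Wd : ℕ} {v : HV} (hv : v ∈ rotStripV H Wd) :
    clsPt b v ∈ rotStripV H Wd := by
  cases b
  · exact hv
  · exact reflX_mem_rotStripV hv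

/-- The class normalisation preserves adjacency. [cite: GlazmanManolescu2019, §4.1 (proof of Proposition 1.1: the concatenation («tour») inequality, arXiv:1708.00395v3 p. 13, unnumbered)] -/
theorem clsPt_adj (b : Bool) {u v : HV} (h : hvGraph.Adj u v) : hvGraph.Adj (clsPt b u) (clsPt b v) := by
  have := (mirIso b).map_adj_iff.2 h
  simpa only [mirIso_apply] using this

/-- The arrival vertex of a composed placement. [cite: GlazmanManolescu2019, §4.1 (proof of Proposition 1.1: the concatenation («tour») inequality, arXiv:1708.00395v3 p. 13, unnumbered)] -/
theorem arrOf_trans (φ θ : hvGraph ≃g hvGraph) (j : Bool) : arrOf (φ.trans θ) j = θ (arrOf φ j) := by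
  cases j <;> rfl

/-! ### G2. The glued tour in frame `c_b₁` and its theorem -/

/-- **The K95.4a tour, both frames**: piece 1 of class `b₁` as it is; pieces 2, 3 placed as in `rotTour` and then
moved by the frame's outer class map `mirIso b₁`. `rotTourG M false = rotTour M`. [cite: GlazmanManolescu2019, §4.1 (proof of Proposition 1.1, arXiv:1708.00395v3 p. 13, Fig. 6), lane ROUTES-G16 §4.4–4.5] -/
def rotTourG (M : ℕ) (b₁ : Bool) (P₁ : List HV) (b₂ : Bool) (P₂ : List HV) (b₃ : Bool) (P₃ : List HV) :
    List HV :=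
  P₁ ++ segOf ((placeIso (rotPhi2 M (exitK P₁)) b₂).trans (mirIso b₁)) (sameB (exitUp P₁) b₂) P₂ ++
    segOf ((placeIso (rotPhi3 M (exitK P₂)) b₃).trans (mirIso b₁)) (sameB (exitUp P₂) b₃) P₃

/-- Frame `c₀` of `rotTourG` IS Part F's `rotTour` (definitionally). [cite: GlazmanManolescu2019, §4.1 (proof of Proposition 1.1: the concatenation («tour») inequality, arXiv:1708.00395v3 p. 13, unnumbered)] -/
theorem rotTourG_false (M : ℕ) (P₁ : List HV) (b₂ : Bool) (P₂ : List HV) (b₃ : Bool) (P₃ : List HV) :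
    rotTourG M false P₁ b₂ P₂ b₃ P₃ = rotTour M P₁ b₂ P₂ b₃ P₃ := rfl

/-- Kernel sanity, frame `c₀`: `tourEx1` again. [folklore] -/
example : rotTourG 1 false
    [((0 : ℤ), (-1 : ℤ), true), ((0 : ℤ), (0 : ℤ), false), ((-1 : ℤ), (0 : ℤ), true), ((-1 : ℤ), (0 : ℤ), false),
      ((-1 : ℤ), (-1 : ℤ), true), ((-1 : ℤ), (-1 : ℤ), false), ((-1 : ℤ), (-2 : ℤ), true), ((-1 : ℤ), (-2 : ℤ), false)]
    false
    [((0 : ℤ), (-1 : ℤ), true), ((0 : ℤ), (0 : ℤ), false), ((-1 : ℤ), (0 : ℤ), true), ((-1 : ℤ), (0 : ℤ), false),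
      ((-1 : ℤ), (-1 : ℤ), true), ((-1 : ℤ), (-1 : ℤ), false), ((-1 : ℤ), (-2 : ℤ), true), ((-1 : ℤ), (-2 : ℤ), false)]
    false
    [((0 : ℤ), (-1 : ℤ), true), ((0 : ℤ), (0 : ℤ), false), ((-1 : ℤ), (0 : ℤ), true), ((-1 : ℤ), (0 : ℤ), false),
      ((-1 : ℤ), (-1 : ℤ), true), ((-1 : ℤ), (-1 : ℤ), false), ((-1 : ℤ), (-2 : ℤ), true), ((-1 : ℤ), (-2 : ℤ), false)] = tourEx1 := by
  decide

/-- Kernel sanity, frame `c₁`: a RIGHT exit of `T_1` (exit `(X, h) = (10, 2)` on the right side line `X = 12 − h`,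
ray-edge index `0`, arriving UP), continued by two class-`R` pieces of `T_0` placed by `reflX ∘ Φ₂(1,0) ∘ reflX` and
`reflX ∘ Φ₃(1,0) ∘ reflX`; the glued list is a mid-walk of `D(28,28) ∖ {a⁻}` ending bottom in the window of block 1. [folklore] -/
example : [((0 : ℤ), (-1 : ℤ), true), ((0 : ℤ), (0 : ℤ), false), ((-1 : ℤ), (0 : ℤ), true), ((-1 : ℤ), (1 : ℤ), false),
    ((-2 : ℤ), (1 : ℤ), true), ((-2 : ℤ), (2 : ℤ), false)] ∈ rotSideWalks true 1 ∧
    exitK [((0 : ℤ), (-1 : ℤ), true), ((0 : ℤ), (0 : ℤ), false), ((-1 : ℤ), (0 : ℤ), true), ((-1 : ℤ), (1 : ℤ), false),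
    ((-2 : ℤ), (1 : ℤ), true), ((-2 : ℤ), (2 : ℤ), false)] = 0 ∧
    exitUp [((0 : ℤ), (-1 : ℤ), true), ((0 : ℤ), (0 : ℤ), false), ((-1 : ℤ), (0 : ℤ), true), ((-1 : ℤ), (1 : ℤ), false),
    ((-2 : ℤ), (1 : ℤ), true), ((-2 : ℤ), (2 : ℤ), false)] = true := by
  refine ⟨?_, by decide, by decide⟩
  rw [mem_rotSideWalks_iff]; exact ⟨by decide, by decide⟩

/-- the frame-`c₁` whole-tour instance at `M = 1`, as a list (kernel sanity of the mirrored placements). [folklore] -/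
def tourExR : List HV :=
  rotTourG 1 true
    [((0 : ℤ), (-1 : ℤ), true), ((0 : ℤ), (0 : ℤ), false), ((-1 : ℤ), (0 : ℤ), true), ((-1 : ℤ), (1 : ℤ), false),
    ((-2 : ℤ), (1 : ℤ), true), ((-2 : ℤ), (2 : ℤ), false)]
    true [wOut, hvOrigin, ((-1 : ℤ), (0 : ℤ), true)] true [wOut, hvOrigin, ((-1 : ℤ), (0 : ℤ), true)]

example : IsMidWalk ((rotStripV 28 28).erase wOut) tourExR ∧ IsRotBotWin 1 (finalDart tourExR) ∧
    mwLen tourExR = 4 + 1 + 1 + 0 + 1 :=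
  ⟨isMidWalk_strip_of (by decide) (by decide), by decide, by decide⟩

/-- **THE GLUING THEOREM, both frames.** For `M ≥ 1`, `H, W ≥ 28M`, a piece `P₁` of class `b₁` of `T_M` (left exit:
frame `c₀`; right exit: frame `c₁`), a piece `P₂` of class `b₂` of `T_{exitK P₁}` and a piece `P₃` of class `b₃` of
`T_{exitK P₂}`, the glued list `rotTourG` is a right-started self-avoiding mid-walk of `D(H, W) ∖ {a⁻}` whose final
dart is a bottom exit in the window of block `M`, of length at most `ℓ(P₁) + ℓ(P₂) + ℓ(P₃) + 2`.  Proof = Part F's,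
in the coordinates `(ξ, Y)`, `Y = X ∘ clsPt b₁`. [cite: GlazmanManolescu2019, §4.1 (proof of Proposition 1.1: the concatenation («tour») inequality, arXiv:1708.00395v3 p. 13, unnumbered), lane ROUTES-G16 §4.4–4.5] -/
theorem rotTourG_spec {M H Wd : ℕ} (hM : 1 ≤ M) (hH : 28 * M ≤ H) (hW : 28 * M ≤ Wd)
    {P₁ P₂ P₃ : List HV} {b₁ b₂ b₃ : Bool} (h₁ : P₁ ∈ rotSideWalks b₁ M)
    (h₂ : P₂ ∈ rotSideWalks b₂ (exitK P₁)) (h₃ : P₃ ∈ rotSideWalks b₃ (exitK P₂)) :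
    IsMidWalk ((rotStripV H Wd).erase wOut) (rotTourG M b₁ P₁ b₂ P₂ b₃ P₃) ∧
      IsRotBotWin M (finalDart (rotTourG M b₁ P₁ b₂ P₂ b₃ P₃)) ∧
      mwLen (rotTourG M b₁ P₁ b₂ P₂ b₃ P₃) ≤ mwLen P₁ + mwLen P₂ + mwLen P₃ + 2 := by
  -- names for the frame data (atoms for `omega`), introduced before anything is derived from `h₂`, `h₃`
  have hK : exitK P₁ ≤ 2 * M := exitK_le h₁
  obtain ⟨K, hKe⟩ : ∃ K, K = exitK P₁ := ⟨_, rfl⟩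
  obtain ⟨up₁, hupe₁⟩ : ∃ b, b = exitUp P₁ := ⟨_, rfl⟩
  rw [← hKe] at h₂ hK
  have hK' : exitK P₂ ≤ 2 * K := exitK_le h₂
  obtain ⟨K', hKe'⟩ : ∃ K', K' = exitK P₂ := ⟨_, rfl⟩
  obtain ⟨up₂, hupe₂⟩ : ∃ b, b = exitUp P₂ := ⟨_, rfl⟩
  rw [← hKe'] at h₃ hK'
  have hK4 : K ≤ 4 * M := by omega
  have hK'4 : K' ≤ 4 * M := by omega
  -- the exit identities and the path facts, before destructuring the pieces
  have hex₁ := clsPt_exit_eq h₁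
  rw [← hKe, ← hupe₁] at hex₁
  have hex₂ := clsPt_exit_eq h₂
  rw [← hKe', ← hupe₂] at hex₂
  have hndP₁ := rotSideWalks_nodup h₁
  have hndP₂ := rotSideWalks_nodup h₂
  have hndP₃ := rotSideWalks_nodup h₃
  have hcP₁ := rotSideWalks_isChain h₁
  have hcP₂ := rotSideWalks_isChain h₂
  have hcP₃ := rotSideWalks_isChain h₃
  obtain ⟨l₁, u₁, hl₁, hP₁, ⟨-, hh₁, -, hV₁, hnd₁⟩, -, hline₁, hu₁a, -, -, hfd₁⟩ := rotSideWalks_anatomy h₁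
  obtain ⟨l₂, u₂, hl₂, hP₂, ⟨-, hh₂, -, hV₂, hnd₂⟩, -, hline₂, hu₂a, -, -, hfd₂⟩ := rotSideWalks_anatomy h₂
  obtain ⟨l₃, u₃, hl₃, hP₃, ⟨-, hh₃, -, hV₃, hnd₃⟩, -, hline₃, hu₃a, hu₃b, -, hfd₃⟩ := rotSideWalks_anatomy h₃
  have hG : rotTourG M b₁ P₁ b₂ P₂ b₃ P₃ =
      P₁ ++ segOf ((placeIso (rotPhi2 M K) b₂).trans (mirIso b₁)) (sameB up₁ b₂) P₂ ++
        segOf ((placeIso (rotPhi3 M K') b₃).trans (mirIso b₁)) (sameB up₂ b₃) P₃ := by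
    rw [rotTourG, hKe, hKe', hupe₁, hupe₂]
  rw [hG]
  -- the two placements, before (`φ`) and after (`ψ = clsPt b₁ ∘ φ`) the outer class map of the frame
  obtain ⟨φ₂, hφ₂⟩ : ∃ ψ : hvGraph ≃g hvGraph, ψ = placeIso (rotPhi2 M K) b₂ := ⟨_, rfl⟩
  obtain ⟨φ₃, hφ₃⟩ : ∃ ψ : hvGraph ≃g hvGraph, ψ = placeIso (rotPhi3 M K') b₃ := ⟨_, rfl⟩
  rw [← hφ₂, ← hφ₃]
  obtain ⟨ψ₂, hψ₂⟩ : ∃ ψ : hvGraph ≃g hvGraph, ψ = φ₂.trans (mirIso b₁) := ⟨_, rfl⟩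
  obtain ⟨ψ₃, hψ₃⟩ : ∃ ψ : hvGraph ≃g hvGraph, ψ = φ₃.trans (mirIso b₁) := ⟨_, rfl⟩
  rw [← hψ₂, ← hψ₃]
  have hφ₂a : ∀ v, φ₂ v = rotPhi2 M K (clsPt b₂ v) := fun v => by rw [hφ₂, placeIso_apply]
  have hφ₃a : ∀ v, φ₃ v = rotPhi3 M K' (clsPt b₃ v) := fun v => by rw [hφ₃, placeIso_apply]
  have hψ₂a : ∀ v, ψ₂ v = clsPt b₁ (φ₂ v) := fun v => by rw [hψ₂]; exact mirIso_apply b₁ (φ₂ v)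
  have hψ₃a : ∀ v, ψ₃ v = clsPt b₁ (φ₃ v) := fun v => by rw [hψ₃]; exact mirIso_apply b₁ (φ₃ v)
  have hYψ₂ : ∀ v, xX (clsPt b₁ (ψ₂ v)) = xX (φ₂ v) := fun v => by rw [hψ₂a, clsPt_clsPt]
  have hYψ₃ : ∀ v, xX (clsPt b₁ (ψ₃ v)) = xX (φ₃ v) := fun v => by rw [hψ₃a, clsPt_clsPt]
  have hξψ₂ : ∀ v, xi (ψ₂ v) = xi (φ₂ v) := fun v => by rw [hψ₂a, xi_clsPt]
  have hξψ₃ : ∀ v, xi (ψ₃ v) = xi (φ₃ v) := fun v => by rw [hψ₃a, xi_clsPt]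
  obtain ⟨hseg₂, hcF₂, hndF₂⟩ := segOf_spec ψ₂.injective (fun x y h => ψ₂.map_adj_iff.2 h) hh₂
    (by rw [← hP₂]; exact hcP₂) (by rw [← hP₂]; exact hndP₂) (sameB up₁ b₂)
  obtain ⟨hseg₃, hcF₃, hndF₃⟩ := segOf_spec ψ₃.injective (fun x y h => ψ₃.map_adj_iff.2 h) hh₃
    (by rw [← hP₃]; exact hcP₃) (by rw [← hP₃]; exact hndP₃) (sameB up₂ b₃)
  rw [← hP₂] at hseg₂ hcF₂ hndF₂
  rw [← hP₃] at hseg₃ hcF₃ hndF₃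
  -- abbreviations for the two segments
  obtain ⟨S₂, hS₂⟩ : ∃ S, S = segOf ψ₂ (sameB up₁ b₂) P₂ := ⟨_, rfl⟩
  obtain ⟨S₃, hS₃⟩ : ∃ S, S = segOf ψ₃ (sameB up₂ b₃) P₃ := ⟨_, rfl⟩
  rw [← hS₂] at hseg₂ hcF₂ hndF₂ ⊢
  rw [← hS₃] at hseg₃ hcF₃ hndF₃ ⊢
  -- JUNCTION 1: piece 1 arrives exactly where `arrival₂ :: S₂` starts
  have harr₂ : arrOf ψ₂ (sameB up₁ b₂) = u₁ := by
    rw [hψ₂, arrOf_trans, hφ₂, arrOf_placeIso, mirIso_apply]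
    rw [hfd₁] at hex₁
    dsimp only at hex₁
    rw [← hex₁, clsPt_clsPt]
  -- JUNCTION 2: piece 2's placed exit vertex is where `arrival₃ :: S₃` starts (cocycle Φ₂(M,K) ∘ Φ₂(K,K') = Φ₃(M,K'))
  have harr₃ : arrOf ψ₃ (sameB up₂ b₃) = ψ₂ u₂ := by
    rw [hψ₃, arrOf_trans, hφ₃, arrOf_placeIso, mirIso_apply, hψ₂a, hφ₂a]
    rw [hfd₂] at hex₂
    dsimp only at hex₂
    rw [hex₂]
    cases up₂
    · simp only [cond_false]; rw [rotPhi2_rotPhi2]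
    · simp only [cond_true]; rw [rotPhi2_rotPhi2]
  -- coordinates of the junction vertices and of the landing vertex
  have cu₁ : 1 ≤ -xi u₁ ∧ xX (clsPt b₁ u₁) + 6 * M = -xi u₁ := ⟨hu₁a, by have := hline₁; omega⟩
  have cψ₂O : 1 ≤ -xi (ψ₂ hvOrigin) ∧ xX (clsPt b₁ (ψ₂ hvOrigin)) + 6 * M = -xi (ψ₂ hvOrigin) := by
    rw [hYψ₂, hξψ₂, hφ₂a]
    obtain ⟨a1, a2⟩ := rotPhi2_wOut_coords M K
    obtain ⟨b1, b2⟩ := rotPhi2_hvOrigin_coords M K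
    cases b₂
    · rw [clsPt_false]; constructor <;> omega
    · rw [clsPt_hvOrigin_true]; constructor <;> omega
  have cψ₂u₂ : 1 ≤ -xi (ψ₂ u₂) ∧ xX (clsPt b₁ (ψ₂ u₂)) + 6 * M = xi (ψ₂ u₂) := by
    rw [← harr₃, hψ₃, arrOf_trans, mirIso_apply, xi_clsPt, clsPt_clsPt, hφ₃, arrOf_placeIso]
    obtain ⟨⟨c1, c2⟩, ⟨d1, d2⟩⟩ := rotPhi3_base_coords M K'
    cases up₂
    · simp only [cond_false]; constructor <;> omega
    · simp only [cond_true]; constructor <;> omega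
  have cψ₃O : 1 ≤ -xi (ψ₃ hvOrigin) ∧ xX (clsPt b₁ (ψ₃ hvOrigin)) + 6 * M = xi (ψ₃ hvOrigin) := by
    rw [hYψ₃, hξψ₃, hφ₃a]
    obtain ⟨⟨c1, c2⟩, ⟨d1, d2⟩⟩ := rotPhi3_base_coords M K'
    cases b₃
    · rw [clsPt_false]; constructor <;> omega
    · rw [clsPt_hvOrigin_true]; constructor <;> omega
  have hline₃' : xX (clsPt b₃ u₃) = -(6 : ℤ) * K' - xi (clsPt b₃ u₃) := by rw [xi_clsPt]; exact hline₃
  have cx₃ : xi (ψ₃ u₃) = 0 ∧ xX (clsPt b₁ (ψ₃ u₃)) = -(6 : ℤ) * M + 2 * xi u₃ := by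
    rw [hYψ₃, hξψ₃, hφ₃a]
    have := rotPhi3_leftLine (M := M) hline₃'
    rwa [xi_clsPt] at this
  have hwin : 6 * (M : ℤ) ≤ |xX (ψ₃ u₃) - 3| ∧ |xX (ψ₃ u₃) - 3| < 120 * M := by
    rw [← abs_clsPt b₁ (ψ₃ u₃), hYψ₃, hφ₃a]
    exact rotPhi3_window hM hK'4 hline₃' (by rw [xi_clsPt]; exact hu₃a) (by rw [xi_clsPt]; exact hu₃b)
  -- placed interior vertices: sectors Σ₂, Σ₃ and the big strip
  have hl₂' : l₂ = hvOrigin :: l₂.tail := eq_cons_tail_of_head hh₂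
  have hl₃' : l₃ = hvOrigin :: l₃.tail := eq_cons_tail_of_head hh₃
  have hnd₂' : (hvOrigin :: l₂.tail).Nodup := by rw [← hl₂']; exact hnd₂
  have hnd₃' : (hvOrigin :: l₃.tail).Nodup := by rw [← hl₃']; exact hnd₃
  have htail₂ : ∀ y ∈ l₂.tail, y ∈ rotTriV K ∧ y ≠ wOut ∧ y ≠ hvOrigin := by
    intro y hy
    have hyl : y ∈ l₂ := by rw [hl₂']; exact List.mem_cons_of_mem _ hy
    have hy' := mem_erase.1 (hV₂ y hyl)
    have hO : hvOrigin ∉ l₂.tail := (List.nodup_cons.1 hnd₂').1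
    exact ⟨hy'.2, hy'.1, fun h => hO (h ▸ hy)⟩
  have htail₃ : ∀ y ∈ l₃.tail, y ∈ rotTriV K' ∧ y ≠ wOut ∧ y ≠ hvOrigin := by
    intro y hy
    have hyl : y ∈ l₃ := by rw [hl₃']; exact List.mem_cons_of_mem _ hy
    have hy' := mem_erase.1 (hV₃ y hyl)
    have hO : hvOrigin ∉ l₃.tail := (List.nodup_cons.1 hnd₃').1
    exact ⟨hy'.2, hy'.1, fun h => hO (h ▸ hy)⟩
  have cmid₂ : ∀ y ∈ l₂.tail, InSector2 M (φ₂ y) ∧ ψ₂ y ∈ rotStripV H Wd := by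
    intro y hy
    obtain ⟨m1, m2, m3⟩ := clsPt_mem (b := b₂) (htail₂ y hy).1 (htail₂ y hy).2.1 (htail₂ y hy).2.2
    rw [hψ₂a, hφ₂a]
    exact ⟨(inSector2_rotPhi2 m1 m2 m3).1, clsPt_mem_rotStripV b₁ (rotPhi2_mem_rotStripV hM hK hH hW m1 m2 m3)⟩
  have cmid₃ : ∀ y ∈ l₃.tail, InSector3 M (φ₃ y) ∧ ψ₃ y ∈ rotStripV H Wd := by
    intro y hy
    obtain ⟨m1, m2, m3⟩ := clsPt_mem (b := b₃) (htail₃ y hy).1 (htail₃ y hy).2.1 (htail₃ y hy).2.2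
    rw [hψ₃a, hφ₃a]
    exact ⟨(inSector3_rotPhi3 m1 m2 m3).1, clsPt_mem_rotStripV b₁ (rotPhi3_mem_rotStripV hM hK'4 hH hW m1 m2 m3)⟩
  have hjunc := junction_mem_rotStripV (H := H) (Wd := Wd) hM hK4 hH hW
  have hjunc' := junction_mem_rotStripV (H := H) (Wd := Wd) hM hK'4 hH hW
  have mψ₂O : ψ₂ hvOrigin ∈ rotStripV H Wd := by
    rw [hψ₂a, hφ₂a]; refine clsPt_mem_rotStripV b₁ ?_; cases b₂
    · rw [clsPt_false]; exact hjunc.2.1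
    · rw [clsPt_hvOrigin_true]; exact hjunc.1
  have mψ₃O : ψ₃ hvOrigin ∈ rotStripV H Wd := by
    rw [hψ₃a, hφ₃a]; refine clsPt_mem_rotStripV b₁ ?_; cases b₃
    · rw [clsPt_false]; exact hjunc'.2.2.2
    · rw [clsPt_hvOrigin_true]; exact hjunc'.2.2.1
  have mψ₂u₂ : ψ₂ u₂ ∈ rotStripV H Wd := by
    rw [← harr₃, hψ₃, arrOf_trans, mirIso_apply, hφ₃, arrOf_placeIso]
    refine clsPt_mem_rotStripV b₁ ?_
    cases up₂
    · exact hjunc'.2.2.1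
    · exact hjunc'.2.2.2
  have mu₁ : u₁ ∈ rotStripV H Wd := by
    rw [← harr₂, hψ₂, arrOf_trans, mirIso_apply, hφ₂, arrOf_placeIso]
    refine clsPt_mem_rotStripV b₁ ?_
    cases up₁
    · exact hjunc.1
    · exact hjunc.2.1
  -- ZONES.  Segment 2: every vertex has `h ≥ 1` and `|X + 6M| ≤ h`, and only its last vertex `ψ₂ u₂` reaches `X + 6M = -h`.
  have Z₂ : ∀ z ∈ S₂, (1 ≤ -xi z ∧ xX (clsPt b₁ z) + 6 * M ≤ -xi z) ∧
      (z = ψ₂ u₂ ∨ -(xX (clsPt b₁ z) + 6 * M) < -xi z) ∧ z ∈ rotStripV H Wd := by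
    intro z hz
    rw [hseg₂] at hz
    simp only [List.mem_append, List.mem_map, List.mem_singleton] at hz
    rcases hz with (hz | ⟨y, hy, rfl⟩) | rfl
    · have := mem_bif_singleton hz; subst this
      exact ⟨⟨cψ₂O.1, by omega⟩, Or.inr (by omega), mψ₂O⟩
    · obtain ⟨⟨s1, s2⟩, sm⟩ := cmid₂ y hy
      have := abs_lt.1 s2
      rw [hξψ₂, hYψ₂]
      exact ⟨⟨s1, by omega⟩, Or.inr (by omega), sm⟩
    · exact ⟨⟨cψ₂u₂.1, by omega⟩, Or.inl rfl, mψ₂u₂⟩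
  -- Segment 3 minus its last vertex: `h ≥ 1` and `X + 6M ≤ -h`; its last vertex is the landing vertex on `ℓ`.
  obtain ⟨R₃, hR₃⟩ : ∃ R, R = (bif sameB up₂ b₃ then [ψ₃ hvOrigin] else []) ++ l₃.tail.map ψ₃ := ⟨_, rfl⟩
  rw [← hR₃] at hseg₃
  have Z₃ : ∀ z ∈ R₃, (1 ≤ -xi z ∧ xX (clsPt b₁ z) + 6 * M ≤ xi z) ∧ z ∈ rotStripV H Wd := by
    intro z hz
    rw [hR₃] at hz
    simp only [List.mem_append, List.mem_map] at hz
    rcases hz with hz | ⟨y, hy, rfl⟩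
    · have := mem_bif_singleton hz; subst this
      exact ⟨⟨cψ₃O.1, by omega⟩, mψ₃O⟩
    · obtain ⟨⟨s1, s2⟩, sm⟩ := cmid₃ y hy
      rw [hξψ₃, hYψ₃]
      exact ⟨⟨s1, by omega⟩, sm⟩
  -- Piece 1's inner vertices: `a⁺` or in `Σ₁`.
  have Z₁ : ∀ x ∈ l₁, ((xi x = 0 ∧ 2 ≤ xX (clsPt b₁ x) ∧ xX (clsPt b₁ x) ≤ 4) ∨
      (1 ≤ -xi x ∧ -xi x < xX (clsPt b₁ x) + 6 * M)) ∧ x ≠ wOut ∧ x ∈ rotStripV H Wd := by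
    intro x hx
    have hx' := mem_erase.1 (hV₁ x hx)
    refine ⟨?_, hx'.1, rotTriV_subset_rotStripV (M := M) (H := H) (Wd := Wd) (by omega) (by omega) hx'.2⟩
    by_cases hxO : x = hvOrigin
    · subst hxO
      rw [xi_hvOrigin]
      exact Or.inl ⟨rfl, xX_clsPt_hvOrigin_bounds b₁⟩
    · obtain ⟨m1, m2, m3⟩ := clsPt_mem (b := b₁) hx'.2 hx'.1 hxO
      rcases mem_rotTriV_iff.1 m1 with h | h | ⟨a1, a2, -⟩
      · exact absurd h m2
      · exact absurd h m3
      · rw [xi_clsPt] at a1 a2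
        exact Or.inr ⟨a1, by omega⟩
  -- THE GLUED LIST as `a⁻ :: (m ++ [x₃])`
  have hS₂ne : S₂ ≠ [] := by rw [hseg₂]; simp
  obtain ⟨m, hm⟩ : ∃ m, m = (l₁ ++ [u₁]) ++ S₂ ++ R₃ := ⟨_, rfl⟩
  have hGm : P₁ ++ S₂ ++ S₃ = wOut :: (m ++ [ψ₃ u₃]) := by
    rw [hP₁, hseg₃, hm]; simp
  have hmne : m ≠ [] := by rw [hm]; simp
  rw [hGm]
  -- membership in `m`
  have hmem : ∀ v ∈ m, v ∈ l₁ ∨ v = u₁ ∨ v ∈ S₂ ∨ v ∈ R₃ := by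
    intro v hv
    rw [hm] at hv
    simp only [List.mem_append, List.mem_singleton] at hv
    rcases hv with ((hv | hv) | hv) | hv
    · exact Or.inl hv
    · exact Or.inr (Or.inl hv)
    · exact Or.inr (Or.inr (Or.inl hv))
    · exact Or.inr (Or.inr (Or.inr hv))
  -- CHAIN
  have hj₁ : P₁.getLast? = some (arrOf ψ₂ (sameB up₁ b₂)) := by
    rw [harr₂, hP₁, List.getLast?_eq_some_getLast (List.cons_ne_nil _ _)]; simp
  have hc12 : (P₁ ++ S₂).IsChain hvGraph.Adj := isChain_append_of_junction hcP₁ hcF₂ hj₁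
  have hj₂ : (P₁ ++ S₂).getLast? = some (arrOf ψ₃ (sameB up₂ b₃)) := by
    rw [harr₃, hseg₂, hP₁, List.getLast?_eq_some_getLast (by simp)]; simp
  have hcG : (wOut :: (m ++ [ψ₃ u₃])).IsChain hvGraph.Adj := by
    rw [← hGm]
    exact isChain_append_of_junction hc12 hcF₃ hj₂
  -- NODUP
  have hndS₂ : S₂.Nodup := hndF₂.of_cons
  have hndS₃ : S₃.Nodup := hndF₃.of_cons
  have hu₁S₂ : u₁ ∉ S₂ := fun h => (List.nodup_cons.1 hndF₂).1 (harr₂ ▸ h)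
  have hψu₂S₃ : ψ₂ u₂ ∉ S₃ := fun h => (List.nodup_cons.1 hndF₃).1 (harr₃ ▸ h)
  have hnd12 : (P₁ ++ S₂).Nodup := by
    refine List.nodup_append'.2 ⟨hndP₁, hndS₂, ?_⟩
    intro v hv1 hv2
    rw [hP₁] at hv1
    simp only [List.mem_cons, List.mem_append, List.not_mem_nil, or_false] at hv1
    obtain ⟨⟨z1, z2⟩, -, -⟩ := Z₂ v hv2
    rcases hv1 with rfl | hv1 | rfl
    · rw [xi_wOut] at z1; omega
    · obtain ⟨hx | hx, -, -⟩ := Z₁ v hv1 <;> omega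
    · exact hu₁S₂ hv2
  have hndG : (wOut :: (m ++ [ψ₃ u₃])).Nodup := by
    rw [← hGm]
    refine List.nodup_append'.2 ⟨hnd12, hndS₃, ?_⟩
    intro v hv1 hv2
    have hv2' : v ∈ R₃ ∨ v = ψ₃ u₃ := by
      rw [hseg₃] at hv2; simpa only [List.mem_append, List.mem_singleton] using hv2
    -- `v` on the left: either the arrival vertex `ψ₂ u₂` (not in `S₃` by self-avoidance of piece 3) or in the zone `X + 6M > -h ∨ h = 0, X ≥ 2`
    by_cases hva : v = ψ₂ u₂
    · exact hψu₂S₃ (hva ▸ hv2)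
    have hzone : (xi v = 0 ∧ 2 ≤ xX (clsPt b₁ v)) ∨ (1 ≤ -xi v ∧ -(xX (clsPt b₁ v) + 6 * M) < -xi v) := by
      rw [hP₁] at hv1
      simp only [List.mem_append, List.mem_cons, List.not_mem_nil, or_false] at hv1
      rcases hv1 with (rfl | hv1 | rfl) | hv1
      · rw [xi_wOut]; exact Or.inl ⟨rfl, (xX_clsPt_wOut_bounds b₁).1⟩
      · obtain ⟨hx | hx, -, -⟩ := Z₁ v hv1
        · exact Or.inl ⟨hx.1, hx.2.1⟩
        · exact Or.inr ⟨hx.1, by omega⟩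
      · exact Or.inr ⟨cu₁.1, by omega⟩
      · obtain ⟨⟨z1, z2⟩, hz | hz, -⟩ := Z₂ v hv1
        · exact absurd hz hva
        · exact Or.inr ⟨z1, hz⟩
    rcases hv2' with hv2' | rfl
    · obtain ⟨⟨z1, z2⟩, -⟩ := Z₃ v hv2'
      rcases hzone with ⟨h0, -⟩ | ⟨h1, h2⟩ <;> omega
    · have hM' : (1 : ℤ) ≤ M := by exact_mod_cast hM
      rcases hzone with ⟨-, h0⟩ | ⟨h1, -⟩
      · rw [cx₃.2] at h0; omega
      · rw [cx₃.1] at h1; omega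
  -- consequences of NODUP for the mid-walk clauses
  have hndm : m.Nodup := (List.nodup_append'.1 (List.nodup_cons.1 hndG).2).1
  have hx₃m : ψ₃ u₃ ∉ m := fun h =>
    (List.nodup_append'.1 (List.nodup_cons.1 hndG).2).2.2 h (List.mem_singleton_self _)
  have hx₃w : ψ₃ u₃ ≠ wOut := fun h => by
    have := cx₃.2; have hb := xX_clsPt_wOut_bounds b₁; rw [h] at this; omega
  -- THE MID-WALK PROPERTY
  have hmid : IsMidWalk ((rotStripV H Wd).erase wOut) (wOut :: (m ++ [ψ₃ u₃])) := by
    have hmc := List.isChain_append.1 hcG.tail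
    refine (isMidWalk_cons_append_iff _ hmne (ψ₃ u₃)).2 ⟨hmc.1, ?_, ?_, ?_, hndm, ?_⟩
    · rw [hm, eq_cons_tail_of_head hh₁]; rfl
    · exact hmc.2.2 _ (by rw [List.getLast?_eq_some_getLast hmne]; rfl) _ rfl
    · intro x hx
      rw [mem_erase]
      rcases hmem x hx with hx | rfl | hx | hx
      · exact ⟨(Z₁ x hx).2.1, (Z₁ x hx).2.2⟩
      · exact ⟨fun h => by rw [h, xi_wOut] at cu₁; omega, mu₁⟩
      · obtain ⟨⟨z1, -⟩, -, zm⟩ := Z₂ x hx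
        exact ⟨fun h => by rw [h, xi_wOut] at z1; omega, zm⟩
      · obtain ⟨⟨z1, -⟩, zm⟩ := Z₃ x hx
        exact ⟨fun h => by rw [h, xi_wOut] at z1; omega, zm⟩
    · intro h
      rcases prevOf_mem m with h' | h'
      · exact hx₃w (h.trans h')
      · exact hx₃m (h ▸ h')
  refine ⟨hmid, ?_, ?_⟩
  · -- THE FINAL DART: a bottom exit `(p, x₃)` in the window of block `M`
    rw [finalDart_cons_append hmne]
    have hmc := List.isChain_append.1 hcG.tail
    have hadj : hvGraph.Adj (m.getLast hmne) (ψ₃ u₃) :=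
      hmc.2.2 _ (by rw [List.getLast?_eq_some_getLast hmne]; rfl) _ rfl
    obtain ⟨p, hp⟩ : ∃ p, p = m.getLast hmne := ⟨_, rfl⟩
    rw [← hp] at hadj ⊢
    have hpm : p ∈ m := hp ▸ List.getLast_mem hmne
    have hco := adj_coord (clsPt_adj b₁ hadj)
    simp only [xi_clsPt] at hco
    have hM' : (1 : ℤ) ≤ M := by exact_mod_cast hM
    -- `p` has height exactly 1 (it is adjacent to `x₃ ∈ ℓ`, and every vertex of `m` off `ℓ` has `h ≥ 1`; the `ℓ`-vertices `a⁺ ∈ m` has `X = 4`, too far)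
    have hxp : xi p = -1 ∧ (xX (clsPt b₁ p) = xX (clsPt b₁ (ψ₃ u₃)) + 1 ∨
        xX (clsPt b₁ p) = xX (clsPt b₁ (ψ₃ u₃)) - 1) := by
      have cx := cx₃
      rcases hmem p hpm with hx | rfl | hx | hx
      · obtain ⟨hx | hx, -, -⟩ := Z₁ p hx <;> omega
      · omega
      · obtain ⟨⟨z1, z2⟩, -, -⟩ := Z₂ p hx; omega
      · obtain ⟨⟨z1, z2⟩, -⟩ := Z₃ p hx; omega
    have hx₃O : ψ₃ u₃ ≠ hvOrigin := fun h => by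
      have := cx₃.2; have hb := xX_clsPt_hvOrigin_bounds b₁; rw [h] at this; omega
    have habs1 : |xX p - 3| = -(xX (clsPt b₁ p) - 3) := by
      rw [← abs_clsPt b₁ p]; exact abs_of_neg (by have := cx₃.2; omega)
    have habs2 : |xX (ψ₃ u₃) - 3| = -(xX (clsPt b₁ (ψ₃ u₃)) - 3) := by
      rw [← abs_clsPt b₁ (ψ₃ u₃)]; exact abs_of_neg (by have := cx₃.2; omega)
    refine ⟨?_, hwin.1, hwin.2⟩
    have hbot : IsRotBotDart (p, ψ₃ u₃) := ⟨hxp.1, cx₃.1, hx₃O, hx₃w⟩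
    rcases hxp.2 with h | h
    · left; refine ⟨hbot, ?_⟩; dsimp only; rw [habs1, habs2]; omega
    · right; refine ⟨hbot, ?_⟩; dsimp only; rw [habs1, habs2]; omega
  · -- THE LENGTH: `ℓ(G) = ℓ(P₁) + ℓ(P₂) + ℓ(P₃) + [junction 1 free] + [junction 2 free] ≤ … + 2`
    rw [mwLen_cons_append, hP₁, hP₂, hP₃, mwLen_cons_append, mwLen_cons_append, mwLen_cons_append, hm, hseg₂, hR₃]
    have e₂ := congrArg List.length hl₂'
    have e₃ := congrArg List.length hl₃'
    simp only [List.length_cons] at e₂ e₃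
    have b2 := length_bif_singleton_le (sameB up₁ b₂) (ψ₂ hvOrigin)
    have b3 := length_bif_singleton_le (sameB up₂ b₃) (ψ₃ hvOrigin)
    simp only [List.length_append, List.length_map, List.length_singleton]
    omega


end Literature.Probability.RandomPlanarGeometry.SAW.HV

/-! ## Section: HexSAWRotTourKeyIneq -/

namespace Literature.Probability.RandomPlanarGeometry.SAW.HV

/-! ### The face of the tour (K95.4a) and the derivation of the block inequality (K95.4) -/

/-- `c_B = 2cos(π/16) > 0`. [cite: Beaton2014RotatedHoneycomb, Proposition 4 (the coefficients)] -/
private theorem cB_posK : 0 < 2 * Real.cos (Real.pi / 16) := by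
  have := Real.cos_pos_of_mem_Ioo (x := Real.pi / 16) ⟨by linarith [Real.pi_pos], by linarith [Real.pi_pos]⟩
  linarith
/-- `c_I = 2sin(π/16) > 0`. [cite: Beaton2014RotatedHoneycomb, Proposition 4 (the coefficients)] -/
private theorem cI_posK : 0 < 2 * Real.sin (Real.pi / 16) := by
  have := Real.sin_pos_of_pos_of_lt_pi (x := Real.pi / 16) (by positivity) (by linarith [Real.pi_pos])
  linarith
/-- `2c_B = 4cos(π/16) > 0`. [cite: Beaton2014RotatedHoneycomb, Proposition 4 (the coefficients)] -/
private theorem cB2_posK : 0 < 4 * Real.cos (Real.pi / 16) := by linarith [cB_posK]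

/-- **K95.4 (face) — the rotated GM tour / block inequality** (ROUTES-G15 §2.3 S3–S5: three pieces in the
three 60°-sectors at the corner `c₀`, junction = RAY-EDGE SHUFFLE, glued walks are bottom exits of the big
strip, `≤ (K/2)/c_I`; blocks `M = 20^i`). THE XL ITEM. [cite: GlazmanManolescu2019, Lemma 4.1 and §4.1] -/
def RotTriBlockIneq : Prop :=
  ∃ A : ℝ, 0 ≤ A ∧ ∀ m : ℕ, ((m : ℝ) + 1) * rotTriW (4 * 20 ^ m) ^ 3 ≤ A

/-! #### K95.4a — the tour, and the derivation of K95.4 -/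

/-- **FACE K95.4a — THE ROTATED GM TOUR** (ROUTES-G15 §2.3 S3–S4; the XL item; everything else of K95.4
is proved in this part): for `M ≥ 1`, a domain `D(H, W)` with `H, W ≥ 28M`, and any uniform lower bounds
`c₂, c₃ ≥ 0` of the junction masses `m_k` over `k ≤ 2M` resp. `k ≤ 4M`:
`x_c² · m_M · c₂ · c₃ ≤` (right-started out/in bottom-exit mass of `D(H, W)` in the window `6M ≤ |X-3| < 120M`).
MECHANISM. Piece 1 = a side-exiting walk of `T_M` toward a base corner `c` (`c₀ = X -6M` for left exits,
`c₁` for right exits: whichever class realises `m_M`; the `c₁`-tour is the mirror image of a `c₀`-tour with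
LEFT-started piece 1), leaving through ray-edge `k ≤ 2M` of the 60°-ray at `c` (a `⊥`-type line: `c` is a
hexagon centre); piece 2 = a walk of the rotated copy `R_c(T'_k)`, `T'_k ≅ T_k` with base on that ray and
start = the midpoint of ray-edge `k`, leaving toward the 120°-ray at ray-edge `k' ≤ 2k`; piece 3 likewise in
`R_c²(T'_{k'})`, leaving through `ℓ` at `|X - 3| ∈ [6M+3, 54M+9]`. JUNCTION = RAY-EDGE SHUFFLE: piece 1
arrives at an endpoint `u` or `u'` of the ray-edge; the four continuations `s→u→w₂` / `s'→u'→u→w₂`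
(next piece LEFT-started, mass `rotSideR k`) and `s'→u'→w₂'` / `s→u→u'→w₂'` (RIGHT-started, mass
`rotSideL k`) are lattice paths, so BOTH start classes are available whatever the arrival vertex, at the
price of ≤ 1 extra vertex per junction (factor `≥ x_c²` in all); fix per `k` the heavier class (`m_k`).
Pieces live in the three open 60°-sectors at `c` (disjoint; ray vertices belong to no piece except as
start/exit vertices); decoding by the maximal prefix inside `V(T_M)`, then inside the second copy ⇒
injective. Containment: rows `≤ 24M+3 ≤ 28M ≤ H`, `|X-3| ≤ 54M+9 < 84M ≤ 3W`. The glued walk is a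
right-started mid-walk of `D(H,W) ∖ {a⁻}` whose final dart is a bottom dart at window distance, of out- or
in-type (`|X₁-3| ≠ |X₂-3|` by parity). Tree templates (parallel frame): `HV.rot60`, `HV.key_ineq`,
`decode_glue` / `glue_injOn` (HexSAWBridgeLogDecay). WHY IT MIGHT FAIL: only through a junction subtlety on
the ray (the four patterns were checked by hand in ROUTES-G15 S4 and are consistent with `chi 2..4`) or a
sizing slip (constants `28`, `6`, `120` are generous). [cite: GlazmanManolescu2019, Lemma 4.1 and §4.1] -/
def RotTourKeyIneq : Prop :=
  ∀ M H Wd : ℕ, 1 ≤ M → 28 * M ≤ H → 28 * M ≤ Wd → ∀ c₂ c₃ : ℝ, 0 ≤ c₂ → 0 ≤ c₃ →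
    (∀ k, k ≤ 2 * M → c₂ ≤ rotChi k) → (∀ k, k ≤ 4 * M → c₃ ≤ rotChi k) →
    hexCriticalFugacity ^ 2 * rotChi M * c₂ * c₃ ≤ rotBotWin M H Wd

/-- **K95.4 DERIVED: `RotTourKeyIneq → RotTriBlockIneq`** (the strip identity K95.1 = tree `rotStrip_identity`, the triangle identity K95.2 enters through the tree's `rotTriW_antitone`), with the
explicit constant `A = (K/2)/c_I · (2c_B)³ / x_c² ≈ 561` (`W_{4·20^m} ≤ (561/(m+1))^{1/3} = 8.25 (m+1)^{-1/3}`
right-started; both-starts twice that = the `16.5 (m+1)^{-1/3}` of ROUTES-G15 §2.3 S5). Blocks `M_i = 20^i`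
(`i ≤ m`) in ONE domain `D(28·20^m, 28·20^m)`; per block K95.4a with `c₂ = c₃ = W_{4·20^m}/(2c_B)`
(K95.4c + `W` antitone from K95.2); the windows are disjoint (K95.4b) and the total bottom mass is
`≤ (K/2)/c_I` (K95.1). [cite: GlazmanManolescu2019, §4.1 (proof of Proposition 1.1)] -/
theorem rotTriBlockIneq_of_tour (h4a : RotTourKeyIneq) :
    RotTriBlockIneq := by
  have hx : 0 < hexCriticalFugacity := hexCriticalFugacity_pos_lt_one.1
  have hKc0 : 0 ≤ 2 * hexCriticalFugacity * Real.cos (Real.pi / 16) / (2 * Real.sin (Real.pi / 16)) :=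
    div_nonneg (by nlinarith [cB_posK]) cI_posK.le
  refine ⟨2 * hexCriticalFugacity * Real.cos (Real.pi / 16) / (2 * Real.sin (Real.pi / 16)) *
      (4 * Real.cos (Real.pi / 16)) ^ 3 / hexCriticalFugacity ^ 2,
    div_nonneg (mul_nonneg hKc0 (pow_nonneg cB2_posK.le 3)) (pow_nonneg hx.le 2), fun m => ?_⟩
  obtain ⟨H, hH⟩ : ∃ H : ℕ, H = 28 * 20 ^ m := ⟨_, rfl⟩
  have hpm : 1 ≤ 20 ^ m := Nat.one_le_pow m 20 (by norm_num)
  have hH1 : 1 ≤ H := by rw [hH]; omega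
  obtain ⟨c, hc⟩ : ∃ c : ℝ, c = rotTriW (4 * 20 ^ m) / (4 * Real.cos (Real.pi / 16)) := ⟨_, rfl⟩
  have hc0 : 0 ≤ c := by rw [hc]; exact div_nonneg (rotTriW_nonneg _) cB2_posK.le
  -- K95.4c + antitone: `c ≤ m_k` for every `k ≤ 4·20^m`
  have hck : ∀ k, k ≤ 4 * 20 ^ m → c ≤ rotChi k := by
    intro k hk
    have ha : rotTriW (4 * 20 ^ m) ≤ rotTriW k := rotTriW_antitone hk
    have hb := rotTriW_le_chi k
    rw [hc, div_le_iff₀ cB2_posK]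
    linarith
  -- per block `20^i`: K95.4a
  have main : ∀ i ∈ range (m + 1), hexCriticalFugacity ^ 2 * c ^ 3 ≤ rotBotWin (20 ^ i) H H := by
    intro i hi
    have him : i ≤ m := Nat.lt_succ_iff.mp (mem_range.mp hi)
    have hpow : 20 ^ i ≤ 20 ^ m := Nat.pow_le_pow_right (by norm_num) him
    have hM : 1 ≤ 20 ^ i := Nat.one_le_pow i 20 (by norm_num)
    have hHM : 28 * 20 ^ i ≤ H := by rw [hH]; exact Nat.mul_le_mul_left 28 hpow
    have key := h4a (20 ^ i) H H hM hHM hHM c c hc0 hc0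
      (fun k hk => hck k (by omega)) (fun k hk => hck k (by omega))
    have hchi : c ≤ rotChi (20 ^ i) := hck (20 ^ i) (by omega)
    have hx2 : 0 ≤ hexCriticalFugacity ^ 2 := by positivity
    calc hexCriticalFugacity ^ 2 * c ^ 3 = hexCriticalFugacity ^ 2 * c * c * c := by ring
      _ ≤ hexCriticalFugacity ^ 2 * rotChi (20 ^ i) * c * c := by
          nlinarith [mul_nonneg (sub_nonneg.2 hchi) (mul_nonneg (mul_nonneg hx2 hc0) hc0)]
      _ ≤ rotBotWin (20 ^ i) H H := key
  have hsum : ((m : ℝ) + 1) * (hexCriticalFugacity ^ 2 * c ^ 3) ≤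
      ∑ i ∈ range (m + 1), rotBotWin (20 ^ i) H H := by
    have := sum_le_sum main
    simp only [sum_const, card_range, nsmul_eq_mul] at this
    push_cast at this
    linarith
  have htot : ((m : ℝ) + 1) * (hexCriticalFugacity ^ 2 * c ^ 3) ≤
      2 * hexCriticalFugacity * Real.cos (Real.pi / 16) / (2 * Real.sin (Real.pi / 16)) :=
    hsum.trans ((rotBotWin_sum_le m H H).trans (rotBot_le_K hH1 hH1))
  -- algebra: `(m+1) W³ = ((m+1) x_c² c³) · (2c_B)³ / x_c²`
  have h4ne : (4 * Real.cos (Real.pi / 16)) ≠ 0 := cB2_posK.ne'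
  have hxne : hexCriticalFugacity ≠ 0 := hx.ne'
  have hcosne : Real.cos (Real.pi / 16) ≠ 0 := (by linarith [cB_posK] : 0 < Real.cos (Real.pi / 16)).ne'
  have e : ((m : ℝ) + 1) * rotTriW (4 * 20 ^ m) ^ 3 =
      ((m : ℝ) + 1) * (hexCriticalFugacity ^ 2 * c ^ 3) *
        ((4 * Real.cos (Real.pi / 16)) ^ 3 / hexCriticalFugacity ^ 2) := by
    rw [hc]
    field_simp
  have hfac : 0 ≤ (4 * Real.cos (Real.pi / 16)) ^ 3 / hexCriticalFugacity ^ 2 :=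
    div_nonneg (pow_nonneg cB2_posK.le 3) (pow_nonneg hx.le 2)
  rw [e]
  calc ((m : ℝ) + 1) * (hexCriticalFugacity ^ 2 * c ^ 3) *
        ((4 * Real.cos (Real.pi / 16)) ^ 3 / hexCriticalFugacity ^ 2)
      ≤ 2 * hexCriticalFugacity * Real.cos (Real.pi / 16) / (2 * Real.sin (Real.pi / 16)) *
        ((4 * Real.cos (Real.pi / 16)) ^ 3 / hexCriticalFugacity ^ 2) :=
        mul_le_mul_of_nonneg_right htot hfac
    _ = _ := by ring


/-! ### H1. Prefix uniqueness -/

/-- A list splits in at most one way as `l ++ u :: r` with every element of `l` in `S` and `u ∉ S`. [cite: GlazmanManolescu2019, §4.1 (proof of Proposition 1.1: the concatenation («tour») inequality, arXiv:1708.00395v3 p. 13, unnumbered)] -/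
private theorem splitMem_unique {S : Finset HV} {l l' r r' : List HV} {u u' : HV}
    (hl : ∀ x ∈ l, x ∈ S) (hl' : ∀ x ∈ l', x ∈ S) (hu : u ∉ S) (hu' : u' ∉ S)
    (h : l ++ u :: r = l' ++ u' :: r') : l = l' ∧ u = u' ∧ r = r' := by
  induction l generalizing l' with
  | nil =>
    cases l' with
    | nil => simpa using h
    | cons a t =>
      simp only [List.nil_append, List.cons_append, List.cons.injEq] at h
      have : u ∈ S := by rw [h.1]; exact hl' a (List.mem_cons.2 (Or.inl rfl))
      exact absurd this hu
  | cons a t ih =>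
    cases l' with
    | nil =>
      simp only [List.nil_append, List.cons_append, List.cons.injEq] at h
      have : u' ∈ S := by rw [← h.1]; exact hl a (List.mem_cons.2 (Or.inl rfl))
      exact absurd this hu'
    | cons a' t' =>
      simp only [List.cons_append, List.cons.injEq] at h
      obtain ⟨h1, h2, h3⟩ := ih (fun x hx => hl x (List.mem_cons_of_mem _ hx))
        (fun x hx => hl' x (List.mem_cons_of_mem _ hx)) h.2
      exact ⟨by rw [h.1, h1], h2, h3⟩

/-! ### H2. Decoding one piece -/

/-- **Piece 1 is the prefix up to the first exit from `T_k`.** [cite: GlazmanManolescu2019, §4.1 (proof of Proposition 1.1: the concatenation («tour») inequality, arXiv:1708.00395v3 p. 13, unnumbered)] -/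
theorem piece1_decode {b : Bool} {k : ℕ} {P P' X X' : List HV} (hP : P ∈ rotSideWalks b k)
    (hP' : P' ∈ rotSideWalks b k) (h : P ++ X = P' ++ X') : P = P' ∧ X = X' := by
  obtain ⟨l, u, hl, hPe, ⟨-, -, -, hV, -⟩, hu, -, -, -, -, -⟩ := rotSideWalks_anatomy hP
  obtain ⟨l', u', hl', hPe', ⟨-, -, -, hV', -⟩, hu', -, -, -, -, -⟩ := rotSideWalks_anatomy hP'
  rw [hPe, hPe'] at h
  simp only [List.cons_append, List.append_assoc, List.cons.injEq, true_and] at h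
  obtain ⟨e1, e2, e3⟩ := splitMem_unique (S := rotTriV k) (fun x hx => (mem_erase.1 (hV x hx)).2)
    (fun x hx => (mem_erase.1 (hV' x hx)).2) hu hu' h
  exact ⟨by rw [hPe, hPe', e1, e2], e3⟩

/-- **A placed piece is the segment up to the first exit from `ψ(T_k)`.** For pieces `P, P'` of the same class of
`T_k`, placed by the same `ψ` with the same junction flag: `segOf ψ j P ++ R = segOf ψ j P' ++ R'` forces `P = P'`
and `R = R'`. [cite: GlazmanManolescu2019, §4.1 (proof of Proposition 1.1: the concatenation («tour») inequality, arXiv:1708.00395v3 p. 13, unnumbered)] -/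
theorem segOf_decode {ψ : hvGraph ≃g hvGraph} {j b : Bool} {k : ℕ} {P P' R R' : List HV}
    (hP : P ∈ rotSideWalks b k) (hP' : P' ∈ rotSideWalks b k)
    (h : segOf ψ j P ++ R = segOf ψ j P' ++ R') : P = P' ∧ R = R' := by
  obtain ⟨l, u, hl, hPe, ⟨-, hh, -, hV, -⟩, hu, -, -, -, -, -⟩ := rotSideWalks_anatomy hP
  obtain ⟨l', u', hl', hPe', ⟨-, hh', -, hV', -⟩, hu', -, -, -, -, -⟩ := rotSideWalks_anatomy hP'
  have hc := rotSideWalks_isChain hP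
  have hnd := rotSideWalks_nodup hP
  have hc' := rotSideWalks_isChain hP'
  have hnd' := rotSideWalks_nodup hP'
  obtain ⟨hseg, -, -⟩ := segOf_spec ψ.injective (fun x y h => ψ.map_adj_iff.2 h) hh
    (by rw [← hPe]; exact hc) (by rw [← hPe]; exact hnd) j
  obtain ⟨hseg', -, -⟩ := segOf_spec ψ.injective (fun x y h => ψ.map_adj_iff.2 h) hh'
    (by rw [← hPe']; exact hc') (by rw [← hPe']; exact hnd') j
  rw [← hPe] at hseg
  rw [← hPe'] at hseg'
  rw [hseg, hseg'] at h
  simp only [List.append_assoc, List.singleton_append] at h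
  have h' := List.append_cancel_left h
  -- `h' : l.tail.map ψ ++ ψ u :: R = l'.tail.map ψ ++ ψ u' :: R'`
  have hin : ∀ (t : List HV), (∀ x ∈ t, x ∈ (rotTriV k).erase wOut) →
      ∀ x ∈ t.tail.map ψ, x ∈ (rotTriV k).image ψ := by
    intro t ht x hx
    obtain ⟨y, hy, rfl⟩ := List.mem_map.1 hx
    exact mem_image.2 ⟨y, (mem_erase.1 (ht y (List.mem_of_mem_tail hy))).2, rfl⟩
  have hout : ∀ (v : HV), v ∉ rotTriV k → ψ v ∉ (rotTriV k).image ψ := by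
    intro v hv hm
    obtain ⟨y, hy, hye⟩ := mem_image.1 hm
    exact hv (ψ.injective hye ▸ hy)
  obtain ⟨e1, e2, e3⟩ := splitMem_unique (hin l hV) (hin l' hV') (hout u hu) (hout u' hu') h'
  have et : l.tail = l'.tail := (List.map_injective_iff.2 ψ.injective) e1
  have eu : u = u' := ψ.injective e2
  refine ⟨?_, e3⟩
  rw [hPe, hPe', eq_cons_tail_of_head hh, eq_cons_tail_of_head hh', et, eu]

/-! ### H3. Decoding the tour -/

/-- **T4 DECODE.** For a fixed frame `b₁` and a fixed class function `β`, the glued tour determines its three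
pieces. [cite: GlazmanManolescu2019, §4.1 (proof of Proposition 1.1: "the concatenation can be decomposed uniquely", arXiv:1708.00395v3 p. 13), lane ROUTES-G16 §4.6] -/
theorem rotTourG_inj {M : ℕ} {b₁ : Bool} (β : ℕ → Bool) {P₁ P₂ P₃ P₁' P₂' P₃' : List HV}
    (h₁ : P₁ ∈ rotSideWalks b₁ M) (h₂ : P₂ ∈ rotSideWalks (β (exitK P₁)) (exitK P₁))
    (h₃ : P₃ ∈ rotSideWalks (β (exitK P₂)) (exitK P₂))
    (h₁' : P₁' ∈ rotSideWalks b₁ M) (h₂' : P₂' ∈ rotSideWalks (β (exitK P₁')) (exitK P₁'))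
    (h₃' : P₃' ∈ rotSideWalks (β (exitK P₂')) (exitK P₂'))
    (h : rotTourG M b₁ P₁ (β (exitK P₁)) P₂ (β (exitK P₂)) P₃ =
      rotTourG M b₁ P₁' (β (exitK P₁')) P₂' (β (exitK P₂')) P₃') :
    P₁ = P₁' ∧ P₂ = P₂' ∧ P₃ = P₃' := by
  simp only [rotTourG, List.append_assoc] at h
  obtain ⟨e₁, h⟩ := piece1_decode h₁ h₁' h
  subst e₁
  obtain ⟨e₂, h⟩ := segOf_decode h₂ h₂' h
  subst e₂
  obtain ⟨e₃, -⟩ := segOf_decode (R := []) (R' := []) h₃ h₃' (by rw [List.append_nil, List.append_nil]; exact h)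
  exact ⟨rfl, rfl, e₃⟩


/-- the junction mass is the mass of the heavier class. [cite: GlazmanManolescu2019, §4.1 (proof of Proposition 1.1: the concatenation («tour») inequality, arXiv:1708.00395v3 p. 13, unnumbered)] -/
theorem rotChi_eq_sum (k : ℕ) :
    rotChi k = ∑ P ∈ rotSideWalks (decide (rotSideL k ≤ rotSideR k)) k, hexCriticalFugacity ^ mwLen P := by
  by_cases h : rotSideL k ≤ rotSideR k
  · rw [decide_eq_true h, rotChi, max_eq_right h]
    exact rotSideR_eq k
  · rw [decide_eq_false h, rotChi, max_eq_left (le_of_lt (not_le.1 h))]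
    exact rotSideL_eq k

/-- **K95.4a — the tour-gluing key inequality (the tour inequality of GM19, proof of Proposition 1.1, arXiv v3 p. 13, in Beaton's frame) is a theorem.**
[cite: GlazmanManolescu2019, §4.1 (proof of Proposition 1.1: the tour inequality, arXiv:1708.00395v3 p. 13); Beaton2014RotatedHoneycomb, §3] -/
theorem rotTourKeyIneq_holds : RotTourKeyIneq := by
  intro M H Wd hM hH hW c₂ c₃ hc₂ hc₃ hb₂ hb₃
  have hx0 : 0 ≤ hexCriticalFugacity := hexCriticalFugacity_pos_lt_one.1.le
  have hx1 : hexCriticalFugacity ≤ 1 := hexCriticalFugacity_pos_lt_one.2.le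
  -- the class function: the class attaining the max
  obtain ⟨β, hβ⟩ : ∃ β : ℕ → Bool, β = fun k => decide (rotSideL k ≤ rotSideR k) := ⟨_, rfl⟩
  have hchi : ∀ k, rotChi k = ∑ P ∈ rotSideWalks (β k) k, hexCriticalFugacity ^ mwLen P := fun k => by
    rw [hβ]; exact rotChi_eq_sum k
  -- the domain of triples and the gluing map
  obtain ⟨D, hD⟩ : ∃ D : Finset (Σ _ : List HV, Σ _ : List HV, List HV),
      D = (rotSideWalks (β M) M).sigma (fun P₁ => (rotSideWalks (β (exitK P₁)) (exitK P₁)).sigma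
        (fun P₂ => rotSideWalks (β (exitK P₂)) (exitK P₂))) := ⟨_, rfl⟩
  obtain ⟨f, hf⟩ : ∃ f : (Σ _ : List HV, Σ _ : List HV, List HV) → List HV,
      f = fun d => rotTourG M (β M) d.1 (β (exitK d.1)) d.2.1 (β (exitK d.2.1)) d.2.2 := ⟨_, rfl⟩
  have hmemD : ∀ d ∈ D, d.1 ∈ rotSideWalks (β M) M ∧ d.2.1 ∈ rotSideWalks (β (exitK d.1)) (exitK d.1) ∧
      d.2.2 ∈ rotSideWalks (β (exitK d.2.1)) (exitK d.2.1) := by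
    intro d hd
    rw [hD, Finset.mem_sigma, Finset.mem_sigma] at hd
    exact ⟨hd.1, hd.2.1, hd.2.2⟩
  have hspec : ∀ d ∈ D, IsMidWalk ((rotStripV H Wd).erase wOut) (f d) ∧ IsRotBotWin M (finalDart (f d)) ∧
      mwLen (f d) ≤ mwLen d.1 + mwLen d.2.1 + mwLen d.2.2 + 2 := by
    intro d hd
    obtain ⟨h₁, h₂, h₃⟩ := hmemD d hd
    rw [hf]
    exact rotTourG_spec hM hH hW h₁ h₂ h₃
  -- (1) injectivity (Part H)
  have hinj : Set.InjOn f ↑D := by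
    intro d hd d' hd' he
    obtain ⟨h₁, h₂, h₃⟩ := hmemD d (Finset.mem_coe.1 hd)
    obtain ⟨h₁', h₂', h₃'⟩ := hmemD d' (Finset.mem_coe.1 hd')
    rw [hf] at he
    obtain ⟨e₁, e₂, e₃⟩ := rotTourG_inj β h₁ h₂ h₃ h₁' h₂' h₃' he
    obtain ⟨P₁, P₂, P₃⟩ := d
    obtain ⟨P₁', P₂', P₃'⟩ := d'
    dsimp only at e₁ e₂ e₃
    subst e₁ e₂ e₃
    rfl
  -- (2) the image lands in the window class of `D(H, W) ∖ {a⁻}`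
  have hsub : D.image f ⊆ (midWalks ((rotStripV H Wd).erase wOut)).filter
      (fun P => IsRotBotWin M (finalDart P)) := by
    intro G hG
    obtain ⟨d, hd, rfl⟩ := Finset.mem_image.1 hG
    obtain ⟨hw, hwin, -⟩ := hspec d hd
    exact Finset.mem_filter.2 ⟨mem_midWalks_iff.2 hw, hwin⟩
  -- (3) the lower bounds along the nested sum
  have inner : ∀ P₁ ∈ rotSideWalks (β M) M, ∀ P₂ ∈ rotSideWalks (β (exitK P₁)) (exitK P₁),
      c₃ ≤ ∑ P₃ ∈ rotSideWalks (β (exitK P₂)) (exitK P₂), hexCriticalFugacity ^ mwLen P₃ := by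
    intro P₁ h₁ P₂ h₂
    rw [← hchi]
    have hk₁ := exitK_le h₁
    have hk₂ := exitK_le h₂
    exact hb₃ _ (by omega)
  have middle : ∀ P₁ ∈ rotSideWalks (β M) M, c₂ * c₃ ≤
      ∑ P₂ ∈ rotSideWalks (β (exitK P₁)) (exitK P₁), hexCriticalFugacity ^ mwLen P₂ *
        ∑ P₃ ∈ rotSideWalks (β (exitK P₂)) (exitK P₂), hexCriticalFugacity ^ mwLen P₃ := by
    intro P₁ h₁
    calc c₂ * c₃ ≤ rotChi (exitK P₁) * c₃ := mul_le_mul_of_nonneg_right (hb₂ _ (exitK_le h₁)) hc₃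
      _ = ∑ P₂ ∈ rotSideWalks (β (exitK P₁)) (exitK P₁), hexCriticalFugacity ^ mwLen P₂ * c₃ := by
          rw [hchi, Finset.sum_mul]
      _ ≤ _ := Finset.sum_le_sum fun P₂ h₂ => mul_le_mul_of_nonneg_left (inner P₁ h₁ P₂ h₂) (pow_nonneg hx0 _)
  have outer : rotChi M * (c₂ * c₃) ≤
      ∑ P₁ ∈ rotSideWalks (β M) M, hexCriticalFugacity ^ mwLen P₁ *
        ∑ P₂ ∈ rotSideWalks (β (exitK P₁)) (exitK P₁), hexCriticalFugacity ^ mwLen P₂ *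
          ∑ P₃ ∈ rotSideWalks (β (exitK P₂)) (exitK P₂), hexCriticalFugacity ^ mwLen P₃ := by
    rw [hchi, Finset.sum_mul]
    exact Finset.sum_le_sum fun P₁ h₁ => mul_le_mul_of_nonneg_left (middle P₁ h₁) (pow_nonneg hx0 _)
  -- (4) Fubini over the sigma domain
  have hsum : ∑ d ∈ D, hexCriticalFugacity ^ mwLen d.1 *
      (hexCriticalFugacity ^ mwLen d.2.1 * hexCriticalFugacity ^ mwLen d.2.2) =
      ∑ P₁ ∈ rotSideWalks (β M) M, hexCriticalFugacity ^ mwLen P₁ *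
        ∑ P₂ ∈ rotSideWalks (β (exitK P₁)) (exitK P₁), hexCriticalFugacity ^ mwLen P₂ *
          ∑ P₃ ∈ rotSideWalks (β (exitK P₂)) (exitK P₂), hexCriticalFugacity ^ mwLen P₃ := by
    rw [hD, Finset.sum_sigma]
    refine Finset.sum_congr rfl fun P₁ _ => ?_
    rw [Finset.mul_sum, Finset.sum_sigma]
    refine Finset.sum_congr rfl fun P₂ _ => ?_
    rw [Finset.mul_sum, Finset.mul_sum]
  -- (5) the chain
  calc hexCriticalFugacity ^ 2 * rotChi M * c₂ * c₃
      = hexCriticalFugacity ^ 2 * (rotChi M * (c₂ * c₃)) := by ring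
    _ ≤ hexCriticalFugacity ^ 2 * ∑ P₁ ∈ rotSideWalks (β M) M, hexCriticalFugacity ^ mwLen P₁ *
          ∑ P₂ ∈ rotSideWalks (β (exitK P₁)) (exitK P₁), hexCriticalFugacity ^ mwLen P₂ *
            ∑ P₃ ∈ rotSideWalks (β (exitK P₂)) (exitK P₂), hexCriticalFugacity ^ mwLen P₃ :=
        mul_le_mul_of_nonneg_left outer (pow_nonneg hx0 2)
    _ = hexCriticalFugacity ^ 2 * ∑ d ∈ D, hexCriticalFugacity ^ mwLen d.1 *
          (hexCriticalFugacity ^ mwLen d.2.1 * hexCriticalFugacity ^ mwLen d.2.2) := by rw [hsum]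
    _ = ∑ d ∈ D, hexCriticalFugacity ^ (mwLen d.1 + mwLen d.2.1 + mwLen d.2.2 + 2) := by
        rw [Finset.mul_sum]
        exact Finset.sum_congr rfl fun d _ => by ring
    _ ≤ ∑ d ∈ D, hexCriticalFugacity ^ mwLen (f d) :=
        Finset.sum_le_sum fun d hd => pow_le_pow_of_le_one hx0 hx1 (hspec d hd).2.2
    _ = ∑ G ∈ D.image f, hexCriticalFugacity ^ mwLen G := by
        rw [Finset.sum_image hinj]
    _ ≤ ∑ G ∈ (midWalks ((rotStripV H Wd).erase wOut)).filter (fun P => IsRotBotWin M (finalDart P)),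
          hexCriticalFugacity ^ mwLen G :=
        Finset.sum_le_sum_of_subset_of_nonneg hsub fun G _ _ => pow_nonneg hx0 _
    _ = rotBotWin M H Wd := rfl

/-- the planner's face K95.4a, closed by name. [cite: GlazmanManolescu2019, §4.1 (proof of Proposition 1.1: the concatenation («tour») inequality, arXiv:1708.00395v3 p. 13, unnumbered)] -/
example : RotTourKeyIneq := rotTourKeyIneq_holds


/-- **K95.4 — the BLOCK INEQUALITY for Beaton's rotated triangles, unconditional**: `∃ A ≥ 0, ∀ m, (m+1) · W_{4·20^m}³ ≤ A`
(from the tree's strip identity, the triangle identity via `rotTriW_antitone`/`rotTriW_le_chi`, and the tour `rotTourKeyIneq_holds`).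
[cite: GlazmanManolescu2019, §4.1 (proof of Proposition 1.1); Beaton2014RotatedHoneycomb, Proposition 4] -/
theorem rotTriBlockIneq_holds : RotTriBlockIneq :=
  rotTriBlockIneq_of_tour rotTourKeyIneq_holds

/-- Discharge of the face `RotTourKeyIneq` under the tree's `<Fact>_holds` naming convention (= `rotTourKeyIneq_holds`). [cite: GlazmanManolescu2019, §4.1 (proof of Proposition 1.1: the concatenation («tour») inequality, arXiv:1708.00395v3 p. 13, unnumbered)] -/
theorem RotTourKeyIneq_holds : RotTourKeyIneq := rotTourKeyIneq_holds

/-- Discharge of the face `RotTriBlockIneq` under the tree's `<Fact>_holds` naming convention (= `rotTriBlockIneq_holds`). [cite: GlazmanManolescu2019, §4.1 (proof of Proposition 1.1)] -/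
theorem RotTriBlockIneq_holds : RotTriBlockIneq := rotTriBlockIneq_holds

end Literature.Probability.RandomPlanarGeometry.SAW.HV
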